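import Mathlib
import Literature.MathematicalPhysics.QuantumFieldTheory.Balaban1983to89.B4Sect5Torus

/-!
# `Balaban1983to89.B6DomainChange` — «the usual estimate of the type (1.12) [3] connected with a change of a domain» (B6 p. 238)

A kernel calculus of THE (1.12)-SHAPE `ε·e^{−δ(d(y,y′) + dist(y,·) + dist(y′,·))}` for differences of operators built on
two domains / two carriers, with the two located uses of it in B6 — (2.85) «the operator with G′(□̃)² − G′²» and
(2.92)/(2.134) «∂P∂* − ∂P_□∂*» (P on 𝔅 against P_□ on the torus T_□) — and the shape of B9 (3.97), typed and proved
with EXPLICIT uniform constants (B6 = T. Bałaban, *Propagators and renormalization transformations for lattice gauge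
theories. II*, Commun. Math. Phys. **96**, 223–250 (1984) [Balaban1984PropagatorsII]; [3] = B4 = T. Bałaban,
*Regularity and decay of lattice Green's functions*, Commun. Math. Phys. **89**, 571–597 (1983)
[Balaban1983RegularityDecay]; B9 = T. Bałaban, *Propagators for lattice gauge theories in a background field*,
Commun. Math. Phys. **99**, 389–434 (1985) [Balaban1985BackgroundPropagators]).

CITATION HEADER (lean-in-tree rule 2026-08-18).  Cell `pub-balaban`, unit `b2b-balaban-b06-g6` (paper sub-cell B06,
gen 6 — the owner lineage of `…B6`, `…B6RandomWalk`, `…B6KernelComposition`, `…B6WeightedEncoding`, `…B6Ineq268`,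
`…B6Ineq283`).  Sources: B6 doi:10.1007/bf01240221, held `paper:balaban1984-cmp96-propagators-rt-ii`, journal page =
PDF page + 222, quotations read from the page renders `b2b-balaban-ref1/pages/1984-cmp96-propagators-rt-II/
1984-cmp96-propagators-rt-II-p016-x2.png` (p. 238), `…-p017-x2.png` (p. 239), `…-p025-x2.png` (p. 247) AS IMAGES;
B9 render `b2b-balaban-ref1/pages/1985-cmp99-background-propagators/1985-cmp99-background-propagators-p024-x2.png`
(p. 412; journal page = PDF page + 388); B4 render `b2b-balaban-ref1/pages/1983-cmp89-regularity-decay/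
1983-cmp89-regularity-decay-p003-x2.png` (p. 573; journal page = PDF page + 570).  Cell rows: GAPS G-B6-11 (the node
this module is a kernel certificate for, parts (a), (b)), G-B9-05 (the hypothesis `hD` of `…B9Eq395Small`), G-B4-01a
(the print defect of (1.12)), C-b06g6-1; DIVERGENCE D-b06.18; journal claim G-B6-11-KERNEL.  Tree inputs:
`…B4Sect5Torus` ((5.6)–(5.10) of [3] over an index set with a pseudo-distance: `Hyp56`, `inv_decay` = (5.7),
`deltaC_bound` = (5.8)/(5.10), `rate`, `bigC`) and `…B4Sect5Proof.inv_sub_inv_eq`.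

THE PRINTED TEXT.  B4 p. 573 [PDF 3], verbatim: *"If Ω ⊂ Ω₀, then for δG_k(Ω, Ω₀, A) defined by the equality
δG_k(Ω, Ω₀, A) = G_k(Ω, A) − G_k(Ω₀, A), (1.11) we have the inequalities (1.5) and (1.6) (with the same restrictions
on x, x′) with the additional factor exp(−δ₀dist(supp f, Ωᶜ) − δ₀dist(supp f, Ωᶜ)) (1.12) on the right hand
sides."* (the doubled `supp f` is a print defect, GAPS G-B4-01a; the tree's (5.9)/(5.10) `B4Sect5Torus.Hyp59`,
`B4Sect5Torus.deltaC_bound` carry dist(x, Ωᶜ) + dist(x′, Ωᶜ), which is the shape typed here).  B6 p. 238 [PDF 16],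
verbatim: *"Similar inequalities hold for kernels of the other operators forming R, for example the operator with
G′(□̃)² − G′² is small and an estimate has the factor e^{−δ₀M} because of the usual estimate of the type (1.12) [3]
connected with a change of a domain. This estimate follows from the random walk representations (2.50) for the
operators G′, G′(□̃). An estimate of the terms with the commutator is even simpler and gives a factor O(M⁻¹)."*, then
(2.85) *"|R(y, y′)| ≤ O(M⁻¹)e^{−δ₁d(y,y′)}(L^{j′}η)^{−d}, y, y′ ∈ 𝔅, y′ ∈ Λ_{j′}"*, and in (2.88) *"δ₂ is determined by
δ₀, δ₁"*; p. 238 bottom: *"A cube □̃ is obtained from □ by taking a sum of 4^d big blocks (of the size M when rescaled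
to the proper scale) with distance to □ equal to 0. In the same way a cube □̃² is formed, with □̃ instead of □ and
built of 6^d big blocks, next a cube □̃³, and so on. We take the cube □̃³ and identify it with a torus, denoted by
T_□, imposing periodicity conditions."*; p. 239 [PDF 17]: *"B^j(Λ) = □̃² ∩ B^{j+1}(Λ_{j+1}), (2.89) and we take Q′*aQ′,
Q*aQ equal to Q′*_{j+1}a_{j+1}Q′_{j+1}, Q*_{j+1}aQ_{j+1} on B^j(Λ), and to Q′*_j a_jQ′_j, Q*_j aQ_j on T_□ \ B^j(Λ).
Let us denote by P_□ the projection operator in (2.17) defined by the above Q′*aQ′"*, *"Both operators are defined on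
the torus T_□."*, the fourth line of (2.92) *"+ (ζ_□(∂P∂* − ∂P_□∂*)h_□A)_μ(x)"*, (2.93) *"(K_{□,□′}A)_μ(x) =
(h²_□(1 − ζ_□)∂P∂*h_{□′}A)_μ(x) if □ ≠ □′"*, and *"The function ζ_□ is of the same type as h_□, but it is equal to 1
on a cube containing □ and with a boundary having the distance 1/3 M to the boundary of □, and it is equal to 0
outside a similar cube with 1/3 M replaced by 2/3 M."*; p. 247 [PDF 25]: *"Applying the inequalities (2.133), (2.88)
and the remarks after the inequality (2.68) we obtain |(K_{□,□′}G_{□′}h_{□′}J)(x)| ≤ O(M⁻¹)e^{−½δ₂d(y,y′)}|J|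
(2.134)"*.  B9 p. 412 [PDF 24], verbatim: *"We have proved in [2] that if we have a difference of propagators defined
on two domains, then in an estimate of this difference we have, besides the usual factors connected with propagators
of a considered type, an exponential factor with a distance between localizations and a closest point where a change
was made. Such inequalities were proved using only the random walk expansions, hence they are valid for all
propagators we have considered in [4]."* … *"can be estimated by the usual factors multiplied by e^{−2δ₀M}. We have to
notice only that the operators may differ outside □̃₀, and the distance from □̃ to □̃₀ᶜ is at least M (on
L^{−j}-scale). This exponential can be estimated by (2δ₀M)⁻¹"*.  No formula for the mechanism is displayed in B6 or
B9; everything below the quotations is OUR typing of it.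

THE TYPING (generalised; OURS).  `S` is a set of points with a pseudo-distance `ρ` (`B4Sect5Torus.IsPseudoDist`:
`ρ ≥ 0`, `ρ s s = 0`, symmetric, triangle inequality — the d(y, y′) of (2.46)/(2.54)) and a DEPTH `β : S → ℝ`,
non-negative and `ρ`-Lipschitz (`IsDepth` — the printed dist(·, Ωᶜ), «a distance between localizations and a closest
point where a change was made»).  Index types carry position maps `p : ι → S` (blocks, sites, bonds; many indices may
sit at one point).  `Profile ρ p K`: `Σ_j e^{−aρ(s, p j)} ≤ K a` for all `a > 0`, `s ∈ S` — the printed c₁(α) of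
(2.61) / the lattice sums of [3] § 5; ALL uniformity lives in `K`.  `Decay ρ pl pm c δ A`: `|A i j| ≤ c·e^{−δρ(pl i,
pm j)}` («the usual factors»).  `Shape ρ β pl pm ε δ D`: `|D i j| ≤ ε·e^{−δ(ρ(pl i, pm j) + β(pl i) + β(pm j))}` — the
(1.12)-shape.  A WINDOW is an injection `e : m → n` of index types along which two carriers are compared
(`Matrix.submatrix`); the FAR SET is the complement of its range, and the hypotheses `hfar` say `β ∘ p` vanishes
there: the change of domain happens at depth 0.

WHAT THIS MODULE PROVES (kernel-checked; no `sorry`; axioms `propext`, `Classical.choice`, `Quot.sound` only; every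
constant an EXPLICIT closed-form function of the structural constants `K, γ₀, c₀, δ₀, …` — never an instance-dependent
existential, which on finite index sets would be vacuous):
§1 the calculus — `Shape.mono/add/sub/neg/submatrix/transpose/of_eq_symm/zero`, `Shape.toDecay`; the one-step sum
`core_sum` and `Shape.mul_right`, `Shape.mul_left` (shape × decay = shape at half the rate with constant `·K(δ/2)`:
the depth is moved across the middle point by the Lipschitz property), `Shape.mul_congr` (`AB − A′B′`); `defect`,
`submatrix_mul` (`(XY)|_W = X|_W·Y|_W + Σ through the far set`) and `defect_shape` (a product THROUGH depth-0 points has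
the shape — the place where the factor e^{−δ·dist} is born); `Shape.of_nearFar`; the bridge to [3] § 5 as typed in the
tree: `Decay.inv_of_hyp56` ((5.7) = `B4Sect5Torus.inv_decay`), `Shape.of_hyp56_compress` ((5.8)/(5.10) =
`B4Sect5Torus.deltaC_bound`: `(A|_W)⁻¹ − A⁻¹|_W` has the shape with `(bigC, rate/4)`), `Shape.inv_sub_inv` (the
second resolvent identity, `B4Sect5Proof.inv_sub_inv_eq`); evaluation: `Shape.apply_le`, `Shape.apply_le_of_depth`
(both indices at depth `≥ M`: the factors `e^{−2δM}` and `(2δM)⁻¹` of B9 p. 412),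
`Decay.apply_le_of_far` (separated supports — (2.93), G-B6-11 (b): `ρ ≥ D` ⇒ a factor `e^{−½δD}` at half the rate).
§A `sq_sub_sq_window`, `sq_sub_sq_window_of_hyp56` — B6 (2.85)'s «operator with G′(□̃)² − G′²» and B9 (3.97)'s
«G′²_{□₀} − G′²_□»: `A` with the placed (5.6) `(γ₀, c₀, δ₀)` on the big carrier, `A_W` with the placed (5.6) on the
window, agreeing with `A|_W` up to a shape `(ε_b, δ₀)` (`ε_b = 0` for a pure change of domain): both
`A_W⁻¹ − A⁻¹|_W` and `A_W⁻¹A_W⁻¹ − (A⁻¹A⁻¹)|_W` have the shape, constants `epsW`, `epsSq`, rates `rate/4`, `rate/12`.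
§B two carriers agreeing on a window — `wa_mul`, `wa_transpose`, `wa_inv`: agreement up to a shape is stable under
products, transposition and inversion (explicit constants).
§C `projection_window_agree` — G-B6-11 (a): two carriers (𝔅: index types `n₁ ⊇ m`, `q₁ ⊇ w`; T_□: `n₂ ⊇ m`,
`q₂ ⊇ w`) with `Δ′_a`-type `A_c` (placed (5.6)), averaging kernels `Q_c` (decay `(cQ, δ₀)`), the coercivity `γB`
of `B_c = Q_cG_cG_cᵀQ_cᵀ` ((2.78)-type; the rest of the (5.6) of `B_c` is derived), exact agreement of `A_c`, `Q_c` on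
the windows and depth 0 off them ⇒ the compressions of `P_c = V_cᵀB_c⁻¹V_c`, `V_c = Q_cA_c⁻¹` (= the printed
`G′Q′*(Q′G′²Q′*)⁻¹Q′G′` for symmetric `G`, `transpose_mul_inv_eq`) differ by a kernel of the shape
`(epsP, deltaP)`, `deltaP = min(rate(Δ′_a)/144, rate(B))/36 > 0` (`deltaP_pos`).

WHAT IT DOES NOT PROVE (honest scope; GAPS C-b06g6-1).  (i) The instantiation — `S` = the block set 𝔅 with the
d(·, ·) of (2.46); the (5.6)-type hypotheses for Δ′_a on 𝔅 and on T_□; the decay of the averaging kernels Q′; the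
coercivity (2.78) of Q′G′²Q′*; the profile `K` = c₁ of (2.61); the exact agreement of the two carriers' Δ′_a, Q′ on
□̃³ («identify it with a torus») — are HYPOTHESES of the theorems, named, never derived here.  (ii) The printed
rates: the print has e^{−δ₀M} in the sentence before (2.85) and e^{−2δ₀M} in (3.97), at the full rate δ₀; the
certificate gives the shape at degraded rates (`rate/12`, `deltaP`: each product halves or thirds the rate, each
inversion quarters it, exactly as in [3] (5.12)–(5.17) and `…B4Sect5Proof`) — equality of rates is NOT claimed
(DIVERGENCE D-b06.18); what is certified is the printed form «δ₂ is determined by δ₀, δ₁» with an O(1) uniform in the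
geometry.  (iii) The translation of an entrywise `Shape` bound into the blocked `B6RandomWalk.HasMajorant` language
of `…B9Eq395Small` (its hypothesis `hD`, with the (P a)⁻¹ normalisation) is not typed here.  (iv) VALUE = kernel
certificate of a located, undisplayed mechanism of the papers under audit; NOT summit progress.
-/

namespace Literature.MathematicalPhysics.QuantumFieldTheory.Balaban1983to89.B6DomainChange

open Finset Real Matrix
open B4Sect5Torus (IsPseudoDist SumBound Hyp56)

variable {S : Type*}

/-! ## §1  The (1.12)-shape calculus over a point set with a pseudo-distance and a depth -/

/-- a DEPTH on the point set: non-negative and `ρ`-Lipschitz — the printed dist(·, Ωᶜ) of (1.12)/(5.9), B9's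
«distance between localizations and a closest point where a change was made». OURS (typing). [folklore] -/
structure IsDepth (ρ : S → S → ℝ) (β : S → ℝ) : Prop where
  nonneg : ∀ s, 0 ≤ β s
  lip : ∀ s t, β s ≤ ρ s t + β t

/-- uniform summation profile of an indexed family of points: `Σ_j e^{−aρ(s, p j)} ≤ K a` for every `a > 0` and every
centre `s` — the c₁(α) of (2.61) / the lattice sums of [3] § 5; the uniformity of every constant below lives in `K`.
[cite: Balaban1984PropagatorsII, (2.61) p.234] -/
def Profile {α : Type*} [Fintype α] (ρ : S → S → ℝ) (p : α → S) (K : ℝ → ℝ) : Prop :=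
  ∀ a : ℝ, 0 < a → ∀ s : S, ∑ j, Real.exp (-(a * ρ s (p j))) ≤ K a

/-- off-diagonal decay of a kernel between two indexed families («the usual factors»): `|A i j| ≤ c·e^{−δρ(pl i, pm j)}`.
[cite: Balaban1983RegularityDecay, (5.7) p.594] -/
def Decay {l m : Type*} (ρ : S → S → ℝ) (pl : l → S) (pm : m → S) (c δ : ℝ) (A : Matrix l m ℝ) : Prop :=
  ∀ i j, |A i j| ≤ c * Real.exp (-(δ * ρ (pl i) (pm j)))

/-- **the (1.12)-shape**: `|D i j| ≤ ε·e^{−δ(ρ(pl i, pm j) + β(pl i) + β(pm j))}` — decay plus the depth of BOTH indices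
(the corrected reading of the printed (1.12), GAPS G-B4-01a; = `B4Sect5Torus.Hyp59` with positions).
[cite: Balaban1983RegularityDecay, (1.12) p.573 + (5.9) p.594] -/
def Shape {l m : Type*} (ρ : S → S → ℝ) (β : S → ℝ) (pl : l → S) (pm : m → S) (ε δ : ℝ)
    (D : Matrix l m ℝ) : Prop :=
  ∀ i j, |D i j| ≤ ε * Real.exp (-(δ * (ρ (pl i) (pm j) + β (pl i) + β (pm j))))

variable {ρ : S → S → ℝ} {β : S → ℝ} {K : ℝ → ℝ}
variable {l m k : Type*}

/-- a profile is a `B4Sect5Torus.SumBound` for the induced pseudo-distance on the index type [folklore] -/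
theorem Profile.sumBound {α : Type*} [Fintype α] {p : α → S} (h : Profile ρ p K) :
    SumBound (fun i j : α => ρ (p i) (p j)) K :=
  fun a ha x => h a ha (p x)

/-- profiles restrict along injections (a sub-family sums to less) [folklore] -/
theorem Profile.comp {α γ : Type*} [Fintype α] [Fintype γ] {p : α → S} (h : Profile ρ p K)
    {f : γ → α} (hf : Function.Injective f) : Profile ρ (p ∘ f) K := by
  intro a ha s
  have h1 : ∑ j : γ, Real.exp (-(a * ρ s ((p ∘ f) j))) =
      ∑ y ∈ Finset.univ.map ⟨f, hf⟩, Real.exp (-(a * ρ s (p y))) := by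
    rw [Finset.sum_map]; rfl
  rw [h1]
  exact (Finset.sum_le_sum_of_subset_of_nonneg (Finset.subset_univ _)
    (fun _ _ _ => (Real.exp_pos _).le)).trans (h a ha s)

/-! ### monotonicity, algebra -/

/-- weakening a decay bound: larger constant, smaller rate [folklore] -/
theorem Decay.mono {pl : l → S} {pm : m → S} {c c' δ δ' : ℝ} {A : Matrix l m ℝ}
    (h : Decay ρ pl pm c δ A) (hρ : IsPseudoDist ρ) (hc0 : 0 ≤ c) (hc : c ≤ c') (hδ : δ' ≤ δ) :
    Decay ρ pl pm c' δ' A := fun i j =>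
  (h i j).trans (B4Sect5Proof.weaken hc0 hc hδ (hρ.nonneg _ _))

/-- weakening a shape: larger constant, smaller rate [folklore] -/
theorem Shape.mono {pl : l → S} {pm : m → S} {ε ε' δ δ' : ℝ} {D : Matrix l m ℝ}
    (h : Shape ρ β pl pm ε δ D) (hρ : IsPseudoDist ρ) (hβ : IsDepth ρ β) (hε0 : 0 ≤ ε) (hε : ε ≤ ε')
    (hδ : δ' ≤ δ) : Shape ρ β pl pm ε' δ' D := fun i j =>
  (h i j).trans (B4Sect5Proof.weaken hε0 hε hδ
    (add_nonneg (add_nonneg (hρ.nonneg _ _) (hβ.nonneg _)) (hβ.nonneg _)))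

/-- shapes add [folklore] -/
theorem Shape.add {pl : l → S} {pm : m → S} {ε₁ ε₂ δ : ℝ} {D₁ D₂ : Matrix l m ℝ}
    (h₁ : Shape ρ β pl pm ε₁ δ D₁) (h₂ : Shape ρ β pl pm ε₂ δ D₂) :
    Shape ρ β pl pm (ε₁ + ε₂) δ (D₁ + D₂) := fun i j => by
  rw [Matrix.add_apply, add_mul]
  exact (abs_add_le _ _).trans (add_le_add (h₁ i j) (h₂ i j))

/-- [folklore] -/
theorem Shape.neg {pl : l → S} {pm : m → S} {ε δ : ℝ} {D : Matrix l m ℝ}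
    (h : Shape ρ β pl pm ε δ D) : Shape ρ β pl pm ε δ (-D) := fun i j => by
  rw [Matrix.neg_apply, abs_neg]; exact h i j

/-- [folklore] -/
theorem Shape.sub {pl : l → S} {pm : m → S} {ε₁ ε₂ δ : ℝ} {D₁ D₂ : Matrix l m ℝ}
    (h₁ : Shape ρ β pl pm ε₁ δ D₁) (h₂ : Shape ρ β pl pm ε₂ δ D₂) :
    Shape ρ β pl pm (ε₁ + ε₂) δ (D₁ - D₂) := by
  rw [sub_eq_add_neg]; exact h₁.add h₂.neg

/-- [folklore] -/
theorem Shape.of_eq_symm {pl : l → S} {pm : m → S} {ε δ : ℝ} {A B : Matrix l m ℝ}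
    (h : Shape ρ β pl pm ε δ (A - B)) : Shape ρ β pl pm ε δ (B - A) := fun i j => by
  rw [← neg_sub, Matrix.neg_apply, abs_neg]; exact h i j

/-- the zero kernel has every shape with a non-negative constant [folklore] -/
theorem Shape.zero (pl : l → S) (pm : m → S) {ε : ℝ} (hε : 0 ≤ ε) (δ : ℝ) :
    Shape ρ β pl pm ε δ (0 : Matrix l m ℝ) := fun i j => by
  rw [Matrix.zero_apply, abs_zero]; positivity

/-- shapes restrict to sub-families (positions composed) [folklore] -/
theorem Shape.submatrix {l' m' : Type*} {pl : l → S} {pm : m → S} {ε δ : ℝ} {D : Matrix l m ℝ}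
    (h : Shape ρ β pl pm ε δ D) (f : l' → l) (g : m' → m) :
    Shape ρ β (pl ∘ f) (pm ∘ g) ε δ (D.submatrix f g) := fun i j => h (f i) (g j)

/-- [folklore] -/
theorem Decay.submatrix {l' m' : Type*} {pl : l → S} {pm : m → S} {c δ : ℝ} {A : Matrix l m ℝ}
    (h : Decay ρ pl pm c δ A) (f : l' → l) (g : m' → m) :
    Decay ρ (pl ∘ f) (pm ∘ g) c δ (A.submatrix f g) := fun i j => h (f i) (g j)

/-- [folklore] -/
theorem Decay.transpose {pl : l → S} {pm : m → S} {c δ : ℝ} {A : Matrix l m ℝ}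
    (h : Decay ρ pl pm c δ A) (hρ : IsPseudoDist ρ) : Decay ρ pm pl c δ A.transpose := fun i j => by
  rw [Matrix.transpose_apply, hρ.symm]; exact h j i

/-- [folklore] -/
theorem Shape.transpose {pl : l → S} {pm : m → S} {ε δ : ℝ} {D : Matrix l m ℝ}
    (h : Shape ρ β pl pm ε δ D) (hρ : IsPseudoDist ρ) : Shape ρ β pm pl ε δ D.transpose := fun i j => by
  rw [Matrix.transpose_apply, hρ.symm, show ρ (pl j) (pm i) + β (pm i) + β (pl j) =
    ρ (pl j) (pm i) + β (pl j) + β (pm i) by ring]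
  exact h j i

/-- forgetting the depth [folklore] -/
theorem Shape.toDecay {pl : l → S} {pm : m → S} {ε δ : ℝ} {D : Matrix l m ℝ}
    (h : Shape ρ β pl pm ε δ D) (hβ : IsDepth ρ β) (hε : 0 ≤ ε) (hδ : 0 ≤ δ) :
    Decay ρ pl pm ε δ D := fun i j => by
  refine (h i j).trans (mul_le_mul_of_nonneg_left (Real.exp_le_exp.mpr ?_) hε)
  have := hβ.nonneg (pl i); have := hβ.nonneg (pm j)
  nlinarith

/-! ### the core one-step summation -/

/-- **the one-step summation**: `Σ_u εe^{−δ(ρ(a,u)+β a+β u)}·ce^{−δρ(u,b)} ≤ εcK(δ/2)e^{−(δ/2)(ρ(a,b)+β a+β b)}` —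
half the rate is spent on the sum over the middle point (profile `K`), the other half carries `ρ(a,b)` (triangle)
and `β b ≤ ρ(u,b) + β u` (Lipschitz depth); the step of [3] (5.12)–(5.17). [cite: Balaban1983RegularityDecay, (5.12)-(5.17) pp.595-596] -/
theorem core_sum [Fintype m] (hρ : IsPseudoDist ρ) (hβ : IsDepth ρ β) {pm : m → S}
    (hP : Profile ρ pm K) {δ ε c : ℝ} (hδ : 0 < δ) (hε : 0 ≤ ε) (hc : 0 ≤ c) (a b : S) :
    ∑ u, ε * Real.exp (-(δ * (ρ a (pm u) + β a + β (pm u)))) * (c * Real.exp (-(δ * ρ (pm u) b))) ≤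
      ε * c * K (δ / 2) * Real.exp (-(δ / 2 * (ρ a b + β a + β b))) := by
  set W := ε * c * Real.exp (-(δ / 2 * (ρ a b + β a + β b))) with hW
  have hW0 : 0 ≤ W := by rw [hW]; positivity
  have step : ∀ u, ε * Real.exp (-(δ * (ρ a (pm u) + β a + β (pm u)))) *
      (c * Real.exp (-(δ * ρ (pm u) b))) ≤ W * Real.exp (-(δ / 2 * ρ a (pm u))) := by
    intro u
    have h1 : ρ a b ≤ ρ a (pm u) + ρ (pm u) b := hρ.triangle _ _ _
    have h2 : β b ≤ ρ (pm u) b + β (pm u) := by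
      have := hβ.lip b (pm u); rwa [hρ.symm] at this
    have h3 : 0 ≤ β a := hβ.nonneg a
    have h4 : 0 ≤ β (pm u) := hβ.nonneg _
    have h5 : 0 ≤ ρ (pm u) b := hρ.nonneg _ _
    have e1 : ε * Real.exp (-(δ * (ρ a (pm u) + β a + β (pm u)))) * (c * Real.exp (-(δ * ρ (pm u) b))) =
        ε * c * Real.exp (-(δ * (ρ a (pm u) + β a + β (pm u))) + -(δ * ρ (pm u) b)) := by
      rw [Real.exp_add]; ring
    have e2 : W * Real.exp (-(δ / 2 * ρ a (pm u))) =
        ε * c * Real.exp (-(δ / 2 * (ρ a b + β a + β b)) + -(δ / 2 * ρ a (pm u))) := by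
      rw [hW, Real.exp_add]; ring
    rw [e1, e2]
    apply mul_le_mul_of_nonneg_left (Real.exp_le_exp.mpr _) (mul_nonneg hε hc)
    nlinarith [mul_le_mul_of_nonneg_left h1 hδ.le, mul_le_mul_of_nonneg_left h2 hδ.le,
      mul_nonneg hδ.le h3, mul_nonneg hδ.le h4, mul_nonneg hδ.le h5]
  calc ∑ u, ε * Real.exp (-(δ * (ρ a (pm u) + β a + β (pm u)))) * (c * Real.exp (-(δ * ρ (pm u) b)))
      ≤ ∑ u, W * Real.exp (-(δ / 2 * ρ a (pm u))) := Finset.sum_le_sum fun u _ => step u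
    _ = W * ∑ u, Real.exp (-(δ / 2 * ρ a (pm u))) := by rw [Finset.mul_sum]
    _ ≤ W * K (δ / 2) := mul_le_mul_of_nonneg_left (hP (δ / 2) (half_pos hδ) a) hW0
    _ = ε * c * K (δ / 2) * Real.exp (-(δ / 2 * (ρ a b + β a + β b))) := by rw [hW]; ring

/-! ### products -/

/-- `|(AB) i j| ≤ Σ_u |A i u|·|B u j|` [folklore] -/
theorem abs_mul_apply_le [Fintype m] (A : Matrix l m ℝ) (B : Matrix m k ℝ) (i : l) (j : k) :
    |(A * B) i j| ≤ ∑ u, |A i u| * |B u j| := by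
  rw [Matrix.mul_apply]
  refine (Finset.abs_sum_le_sum_abs _ _).trans (le_of_eq (Finset.sum_congr rfl fun u _ => abs_mul _ _))

/-- shape × decay = shape at half the rate (the depth crosses the middle point by the Lipschitz property) [folklore] -/
theorem Shape.mul_right [Fintype m] (hρ : IsPseudoDist ρ) (hβ : IsDepth ρ β) {pl : l → S} {pm : m → S}
    {pk : k → S} (hP : Profile ρ pm K) {ε c δ : ℝ} (hδ : 0 < δ) (hε : 0 ≤ ε) (hc : 0 ≤ c)
    {D : Matrix l m ℝ} {Y : Matrix m k ℝ} (hD : Shape ρ β pl pm ε δ D) (hY : Decay ρ pm pk c δ Y) :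
    Shape ρ β pl pk (ε * c * K (δ / 2)) (δ / 2) (D * Y) := by
  intro i j
  refine (abs_mul_apply_le D Y i j).trans ?_
  refine le_trans (Finset.sum_le_sum fun u _ => ?_) (core_sum hρ hβ hP hδ hε hc (pl i) (pk j))
  exact mul_le_mul (hD i u) (hY u j) (abs_nonneg _) (by positivity)

/-- decay × shape [folklore] -/
theorem Shape.mul_left [Fintype l] (hρ : IsPseudoDist ρ) (hβ : IsDepth ρ β) {pk : k → S} {pl : l → S}
    {pm : m → S} (hP : Profile ρ pl K) {ε c δ : ℝ} (hδ : 0 < δ) (hε : 0 ≤ ε) (hc : 0 ≤ c)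
    {X : Matrix k l ℝ} {D : Matrix l m ℝ} (hX : Decay ρ pk pl c δ X) (hD : Shape ρ β pl pm ε δ D) :
    Shape ρ β pk pm (c * ε * K (δ / 2)) (δ / 2) (X * D) := by
  intro i j
  refine (abs_mul_apply_le X D i j).trans ?_
  have key := core_sum hρ hβ hP hδ hε hc (pm j) (pk i)
  have e1 : ∀ u, |X i u| * |D u j| ≤ ε * Real.exp (-(δ * (ρ (pm j) (pl u) + β (pm j) + β (pl u)))) *
      (c * Real.exp (-(δ * ρ (pl u) (pk i)))) := by
    intro u
    rw [mul_comm]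
    refine mul_le_mul ?_ ?_ (abs_nonneg _) (by positivity)
    · rw [hρ.symm, show ρ (pl u) (pm j) + β (pm j) + β (pl u) = ρ (pl u) (pm j) + β (pl u) + β (pm j) by ring]
      exact hD u j
    · rw [hρ.symm]; exact hX i u
  refine (Finset.sum_le_sum fun u _ => e1 u).trans (key.trans (le_of_eq ?_))
  rw [hρ.symm (pm j) (pk i), show ρ (pk i) (pm j) + β (pm j) + β (pk i) =
    ρ (pk i) (pm j) + β (pk i) + β (pm j) by ring]
  ring

/-- congruence of products: `AB − A′B′ = (A − A′)B + A′(B − B′)` [folklore] -/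
theorem Shape.mul_congr [Fintype l] (hρ : IsPseudoDist ρ) (hβ : IsDepth ρ β) {pk : k → S} {pl : l → S}
    {pm : m → S} (hP : Profile ρ pl K) {ε₁ ε₂ cA cB δ : ℝ} (hδ : 0 < δ) (hε₁ : 0 ≤ ε₁) (hε₂ : 0 ≤ ε₂)
    (hcA : 0 ≤ cA) (hcB : 0 ≤ cB) {A A' : Matrix k l ℝ} {B B' : Matrix l m ℝ}
    (hA : Shape ρ β pk pl ε₁ δ (A - A')) (hB : Shape ρ β pl pm ε₂ δ (B - B'))
    (hA' : Decay ρ pk pl cA δ A') (hBd : Decay ρ pl pm cB δ B) :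
    Shape ρ β pk pm ((ε₁ * cB + cA * ε₂) * K (δ / 2)) (δ / 2) (A * B - A' * B') := by
  have e : A * B - A' * B' = (A - A') * B + A' * (B - B') := by
    rw [Matrix.sub_mul, Matrix.mul_sub]; abel
  rw [e, show (ε₁ * cB + cA * ε₂) * K (δ / 2) = ε₁ * cB * K (δ / 2) + cA * ε₂ * K (δ / 2) by ring]
  exact (hA.mul_right hρ hβ hP hδ hε₁ hcB hBd).add (Shape.mul_left hρ hβ hP hδ hε₂ hcA hA' hB)

/-! ### restriction to a window: the defect through the far set -/

section Defect

variable {n l' k' : Type*} [Fintype n] [DecidableEq n] [Fintype m]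

/-- the DEFECT of a product under compression to a window `e`: the part of the middle sum running through the far
set (the complement of the range of `e`). OURS (typing). [folklore] -/
def defect (e : m → n) (A : Matrix l n ℝ) (B : Matrix n k ℝ) (f : l' → l) (g : k' → k) :
    Matrix l' k' ℝ :=
  Matrix.of fun i j => ∑ s, if (∃ u, e u = s) then 0 else A (f i) s * B s (g j)

omit [Fintype n] [DecidableEq n] [Fintype m] in
/-- [folklore] -/
theorem defect_apply [Fintype n] [DecidableEq n] [Fintype m] (e : m → n) (A : Matrix l n ℝ)
    (B : Matrix n k ℝ) (f : l' → l) (g : k' → k) (i : l') (j : k') :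
    defect e A B f g i j = ∑ s, if (∃ u, e u = s) then 0 else A (f i) s * B s (g j) := rfl

/-- compression of a product = product of the compressions + the defect [folklore] -/
theorem submatrix_mul (A : Matrix l n ℝ) (B : Matrix n k ℝ) {e : m → n} (he : Function.Injective e)
    (f : l' → l) (g : k' → k) :
    (A * B).submatrix f g = A.submatrix f e * B.submatrix e g + defect e A B f g := by
  ext i j
  simp only [Matrix.submatrix_apply, Matrix.mul_apply, Matrix.add_apply, defect_apply]
  exact B4Sect5Torus.sum_split he (fun s => A (f i) s * B s (g j))

/-- **the defect has the (1.12)-shape** when the depth vanishes on the far set — the place where the factor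
`e^{−δ·dist}` of (1.12) is born: a path through a depth-0 point `z` pays `ρ(i,z) + ρ(z,j) ≥ β i + β j` (Lipschitz).
[cite: Balaban1983RegularityDecay, (1.12) p.573] -/
theorem defect_shape (hρ : IsPseudoDist ρ) (hβ : IsDepth ρ β) {pl : l → S} {pn : n → S} {pk : k → S}
    (hP : Profile ρ pn K) {cA cB δ : ℝ} (hδ : 0 < δ) (hcA : 0 ≤ cA) (hcB : 0 ≤ cB)
    {A : Matrix l n ℝ} {B : Matrix n k ℝ} (hA : Decay ρ pl pn cA δ A) (hB : Decay ρ pn pk cB δ B)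
    {e : m → n} (hfar : ∀ z, (¬ ∃ u, e u = z) → β (pn z) = 0) (f : l' → l) (g : k' → k) :
    Shape ρ β (pl ∘ f) (pk ∘ g) (cA * cB * K (δ / 3)) (δ / 3) (defect e A B f g) := by
  intro i j
  set a := pl (f i) with ha
  set b := pk (g j) with hb
  set W := cA * cB * Real.exp (-(δ / 3 * (ρ a b + β a + β b))) with hW
  have hW0 : 0 ≤ W := by rw [hW]; positivity
  have step : ∀ s, |(if (∃ u, e u = s) then (0 : ℝ) else A (f i) s * B s (g j))| ≤
      W * Real.exp (-(δ / 3 * ρ a (pn s))) := by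
    intro s
    by_cases hs : ∃ u, e u = s
    · rw [if_pos hs, abs_zero]; positivity
    · rw [if_neg hs, abs_mul]
      have h0 : β (pn s) = 0 := hfar s hs
      have h1 : ρ a b ≤ ρ a (pn s) + ρ (pn s) b := hρ.triangle _ _ _
      have h2 : β a ≤ ρ a (pn s) := by have := hβ.lip a (pn s); rw [h0] at this; linarith
      have h3 : β b ≤ ρ (pn s) b := by
        have := hβ.lip b (pn s); rw [h0, hρ.symm] at this; linarith
      have h4 : 0 ≤ ρ (pn s) b := hρ.nonneg _ _
      have e1 : cA * Real.exp (-(δ * ρ a (pn s))) * (cB * Real.exp (-(δ * ρ (pn s) b))) =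
          cA * cB * Real.exp (-(δ * ρ a (pn s)) + -(δ * ρ (pn s) b)) := by rw [Real.exp_add]; ring
      have e2 : W * Real.exp (-(δ / 3 * ρ a (pn s))) =
          cA * cB * Real.exp (-(δ / 3 * (ρ a b + β a + β b)) + -(δ / 3 * ρ a (pn s))) := by
        rw [hW, Real.exp_add]; ring
      calc |A (f i) s| * |B s (g j)|
          ≤ cA * Real.exp (-(δ * ρ a (pn s))) * (cB * Real.exp (-(δ * ρ (pn s) b))) :=
            mul_le_mul (hA (f i) s) (hB s (g j)) (abs_nonneg _) (by positivity)
        _ ≤ W * Real.exp (-(δ / 3 * ρ a (pn s))) := by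
            rw [e1, e2]
            apply mul_le_mul_of_nonneg_left (Real.exp_le_exp.mpr _) (mul_nonneg hcA hcB)
            nlinarith [mul_le_mul_of_nonneg_left h1 hδ.le, mul_le_mul_of_nonneg_left h2 hδ.le,
              mul_le_mul_of_nonneg_left h3 hδ.le, mul_nonneg hδ.le h4]
  rw [defect_apply]
  calc |∑ s, if (∃ u, e u = s) then (0 : ℝ) else A (f i) s * B s (g j)|
      ≤ ∑ s, |(if (∃ u, e u = s) then (0 : ℝ) else A (f i) s * B s (g j))| :=
        Finset.abs_sum_le_sum_abs _ _
    _ ≤ ∑ s, W * Real.exp (-(δ / 3 * ρ a (pn s))) := Finset.sum_le_sum fun s _ => step s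
    _ = W * ∑ s, Real.exp (-(δ / 3 * ρ a (pn s))) := by rw [Finset.mul_sum]
    _ ≤ W * K (δ / 3) := mul_le_mul_of_nonneg_left (hP (δ / 3) (by positivity) a) hW0
    _ = cA * cB * K (δ / 3) * Real.exp (-(δ / 3 * (ρ a b + β a + β b))) := by rw [hW]; ring

end Defect

/-! ### sources of the shape -/

/-- a decaying perturbation supported at depth `≤ r` on both sides has the shape with constant `·e^{2δr}` [folklore] -/
theorem Shape.of_nearFar {pl : l → S} {pm : m → S} {d₀ δ r : ℝ} (hd : 0 ≤ d₀)
    (hδ : 0 ≤ δ) {E : Matrix l m ℝ} (hE : Decay ρ pl pm d₀ δ E)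
    (hsupp : ∀ i j, E i j ≠ 0 → β (pl i) ≤ r ∧ β (pm j) ≤ r) :
    Shape ρ β pl pm (d₀ * Real.exp (2 * δ * r)) δ E := by
  intro i j
  by_cases h0 : E i j = 0
  · rw [h0, abs_zero]; positivity
  · obtain ⟨hi, hj⟩ := hsupp i j h0
    refine (hE i j).trans ?_
    rw [mul_assoc, ← Real.exp_add]
    apply mul_le_mul_of_nonneg_left (Real.exp_le_exp.mpr _) hd
    nlinarith

section Hyp56

variable {n : Type*} [Fintype n] [DecidableEq n] [Fintype m] [DecidableEq m]

/-- (5.7) with positions: decay of the inverse under the placed (5.6) (`B4Sect5Torus.inv_decay`).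
[cite: Balaban1983RegularityDecay, (5.7) p.594] -/
theorem Decay.inv_of_hyp56 (hK : ∀ a, 0 < a → 0 ≤ K a) {γ₀ c₀ δ₀ : ℝ} (hγ : 0 < γ₀) (hc : 0 ≤ c₀)
    (hδ : 0 < δ₀) (hρ : IsPseudoDist ρ) {pn : n → S} (hP : Profile ρ pn K) {A : Matrix n n ℝ}
    (hA : Hyp56 (fun i j => ρ (pn i) (pn j)) A γ₀ c₀ δ₀) :
    Decay ρ pn pn (2 / γ₀) (B4Sect5Torus.rate K γ₀ c₀ δ₀) A⁻¹ := fun p q =>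
  B4Sect5Torus.inv_decay hK hγ hc hδ (hρ.comp pn) hP.sumBound hA p q

omit [DecidableEq n] [DecidableEq m] in
/-- the placed (5.6) passes to compressions along injections (`B4Sect5Torus.hyp56_submatrix`) [folklore] -/
theorem hyp56_submatrix {pn : n → S} {A : Matrix n n ℝ} {γ₀ c₀ δ₀ : ℝ}
    (hA : Hyp56 (fun i j => ρ (pn i) (pn j)) A γ₀ c₀ δ₀) {e : m → n} (he : Function.Injective e) :
    Hyp56 (fun i j => ρ ((pn ∘ e) i) ((pn ∘ e) j)) (A.submatrix e e) γ₀ c₀ δ₀ :=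
  B4Sect5Torus.hyp56_submatrix hA he

/-- (5.8)/(5.10) with positions: `(A|_W)⁻¹ − A⁻¹|_W` has the (1.12)-shape for ANY depth vanishing on the far set,
constants `(bigC, rate/4)` of `B4Sect5Torus.deltaC_bound`. [cite: Balaban1983RegularityDecay, (5.8) + (5.10) p.594] -/
theorem Shape.of_hyp56_compress (hK : ∀ a, 0 < a → 0 ≤ K a) {γ₀ c₀ δ₀ : ℝ} (hγ : 0 < γ₀)
    (hc : 0 < c₀) (hδ : 0 < δ₀) (hρ : IsPseudoDist ρ) (hβ : IsDepth ρ β) {pn : n → S}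
    (hP : Profile ρ pn K) {A : Matrix n n ℝ} (hA : Hyp56 (fun i j => ρ (pn i) (pn j)) A γ₀ c₀ δ₀)
    {e : m → n} (he : Function.Injective e) (hfar : ∀ z, (¬ ∃ u, e u = z) → β (pn z) = 0) :
    Shape ρ β (pn ∘ e) (pn ∘ e) (B4Sect5Torus.bigC K γ₀ c₀ δ₀) (B4Sect5Torus.rate K γ₀ c₀ δ₀ / 4)
      ((A.submatrix e e)⁻¹ - (A⁻¹).submatrix e e) := by
  intro p q
  have h := B4Sect5Torus.deltaC_bound hK hγ hc hδ (hρ.comp pn) hP.sumBound hA he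
    (β := fun i => β (pn (e i))) (fun i => hβ.nonneg _)
    (fun i z hz => by
      have := hβ.lip (pn (e i)) (pn z); rw [hfar z hz] at this; linarith) p q
  rw [Matrix.sub_apply, Matrix.submatrix_apply]
  exact h

end Hyp56

/-! ### inverses: the second resolvent identity -/

/-- `A⁻¹ − A′⁻¹ = A⁻¹(A′ − A)A′⁻¹` (`B4Sect5Proof.inv_sub_inv_eq`) carries the shape of `A′ − A` (two one-step
summations). [folklore] -/
theorem Shape.inv_sub_inv [Fintype m] [DecidableEq m] (hρ : IsPseudoDist ρ) (hβ : IsDepth ρ β)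
    {pm : m → S} (hP : Profile ρ pm K) {ε c c' δ : ℝ} (hδ : 0 < δ) (hε : 0 ≤ ε) (hc : 0 ≤ c)
    (hc' : 0 ≤ c') (hK : ∀ a, 0 < a → 0 ≤ K a) {A A' : Matrix m m ℝ} (hA : IsUnit A) (hA' : IsUnit A')
    (hiA : Decay ρ pm pm c δ A⁻¹) (hiA' : Decay ρ pm pm c' δ A'⁻¹) (hD : Shape ρ β pm pm ε δ (A' - A)) :
    Shape ρ β pm pm (c * ε * K (δ / 2) * c' * K (δ / 4)) (δ / 4) (A⁻¹ - A'⁻¹) := by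
  rw [B4Sect5Proof.inv_sub_inv_eq hA hA']
  have h1 : Shape ρ β pm pm (c * ε * K (δ / 2)) (δ / 2) (A⁻¹ * (A' - A)) :=
    Shape.mul_left hρ hβ hP hδ hε hc hiA hD
  have h2 : Decay ρ pm pm c' (δ / 2) A'⁻¹ := hiA'.mono hρ hc' le_rfl (by linarith)
  have h3 := h1.mul_right hρ hβ hP (half_pos hδ) (by
    have := hK (δ / 2) (half_pos hδ); positivity) hc' h2
  rw [show δ / 2 / 2 = δ / 4 by ring] at h3
  exact h3

/-! ### evaluation: deep points, far supports -/

/-- at indices of depth `≥ d₁`, `≥ d₂` the shape gives the extra factor `e^{−δ(d₁+d₂)}` [folklore] -/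
theorem Shape.apply_le {pl : l → S} {pm : m → S} {ε δ : ℝ} {D : Matrix l m ℝ}
    (h : Shape ρ β pl pm ε δ D) (hε : 0 ≤ ε) (hδ : 0 ≤ δ) {i : l} {j : m} {d₁ d₂ : ℝ}
    (hi : d₁ ≤ β (pl i)) (hj : d₂ ≤ β (pm j)) :
    |D i j| ≤ ε * Real.exp (-(δ * (d₁ + d₂))) * Real.exp (-(δ * ρ (pl i) (pm j))) := by
  refine (h i j).trans ?_
  rw [mul_assoc, ← Real.exp_add]
  apply mul_le_mul_of_nonneg_left (Real.exp_le_exp.mpr _) hε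
  nlinarith

/-- a decaying kernel between far-apart points (`ρ ≥ dd`): half the rate pays for the separation — the mechanism of
(2.93)/G-B6-11 (b) (*"(1 − ζ_□)"* against *"h_{□′}"*, *"□ ≠ □′"*). [folklore] -/
theorem Decay.apply_le_of_far {pl : l → S} {pm : m → S} {c δ : ℝ} {A : Matrix l m ℝ}
    (h : Decay ρ pl pm c δ A) (hc : 0 ≤ c) (hδ : 0 ≤ δ) {i : l} {j : m} {dd : ℝ}
    (hfar : dd ≤ ρ (pl i) (pm j)) :
    |A i j| ≤ c * Real.exp (-(δ / 2 * dd)) * Real.exp (-(δ / 2 * ρ (pl i) (pm j))) := by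
  refine (h i j).trans ?_
  rw [mul_assoc, ← Real.exp_add]
  apply mul_le_mul_of_nonneg_left (Real.exp_le_exp.mpr _) hc
  nlinarith


/-! ## §A  Application 1 — the square of a localised Green's function against the square of the global one:
B6 p. 238 *"the operator with G′(□̃)² − G′² is small and an estimate has the factor e^{−δ₀M}"*, B9 p. 412 (3.97)
*"□̃Q′(G′²_{□₀} − G′²_□)Q′*□ can be estimated by the usual factors multiplied by e^{−2δ₀M}"* -/

section Square

variable {n : Type*} [Fintype n] [DecidableEq n] [Fintype m] [DecidableEq m]

omit [DecidableEq m] in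
/-- **Abstract form.**  `G` a decaying kernel on the big carrier, `G_L` a decaying kernel on the window, and the
(1.12)-input `G_L − G|_W` of shape `(ε, δ)`; then `G_L² − (G²)|_W` has the shape
`(2εcK(δ/2) + c²K(δ/3), δ/3)` — the squares are compared through `(G²)|_W = G|_W·G|_W + defect`. [folklore] -/
theorem sq_sub_sq_window (hρ : IsPseudoDist ρ) (hβ : IsDepth ρ β) (hK : ∀ a, 0 < a → 0 ≤ K a)
    {pn : n → S} (hPn : Profile ρ pn K)
    {e : m → n} (he : Function.Injective e) (hfar : ∀ z, (¬ ∃ u, e u = z) → β (pn z) = 0)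
    {c ε δ : ℝ} (hδ : 0 < δ) (hc : 0 ≤ c) (hε : 0 ≤ ε)
    {G : Matrix n n ℝ} {Gw : Matrix m m ℝ} (hG : Decay ρ pn pn c δ G)
    (hGw : Decay ρ (pn ∘ e) (pn ∘ e) c δ Gw) (hW : Shape ρ β (pn ∘ e) (pn ∘ e) ε δ (Gw - G.submatrix e e)) :
    Shape ρ β (pn ∘ e) (pn ∘ e) (2 * ε * c * K (δ / 2) + c * c * K (δ / 3)) (δ / 3)
      (Gw * Gw - (G * G).submatrix e e) := by
  have hPm : Profile ρ (pn ∘ e) K := hPn.comp he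
  have hK2 : 0 ≤ K (δ / 2) := hK _ (half_pos hδ)
  have h1 := Shape.mul_congr hρ hβ hPm hδ hε hε hc hc hW hW (hG.submatrix e e) hGw
  have h1' : Shape ρ β (pn ∘ e) (pn ∘ e) ((ε * c + c * ε) * K (δ / 2)) (δ / 3)
      (Gw * Gw - G.submatrix e e * G.submatrix e e) :=
    h1.mono hρ hβ (by positivity) le_rfl (by linarith)
  have h2 := defect_shape hρ hβ hPn hδ hc hc hG hG hfar e e
  have e1 : Gw * Gw - (G * G).submatrix e e =
      (Gw * Gw - G.submatrix e e * G.submatrix e e) - defect e G G e e := by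
    rw [submatrix_mul G G he e e]; abel
  rw [e1, show 2 * ε * c * K (δ / 2) + c * c * K (δ / 3) = (ε * c + c * ε) * K (δ / 2) + c * c * K (δ / 3)
    by ring]
  exact h1'.sub h2

/-- the constant of `sq_sub_sq_window_of_hyp56` for the (1.12)-input `G_L − G|_W` [folklore] -/
noncomputable def epsW (K : ℝ → ℝ) (γ₀ c₀ δ₀ εb : ℝ) : ℝ :=
  2 / γ₀ * εb * K (B4Sect5Torus.rate K γ₀ c₀ δ₀ / 2) * (2 / γ₀) * K (B4Sect5Torus.rate K γ₀ c₀ δ₀ / 4) +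
    B4Sect5Torus.bigC K γ₀ c₀ δ₀

/-- the constant of `sq_sub_sq_window_of_hyp56` for `G_L² − (G²)|_W` [folklore] -/
noncomputable def epsSq (K : ℝ → ℝ) (γ₀ c₀ δ₀ εb : ℝ) : ℝ :=
  2 * epsW K γ₀ c₀ δ₀ εb * (2 / γ₀) * K (B4Sect5Torus.rate K γ₀ c₀ δ₀ / 8) +
    2 / γ₀ * (2 / γ₀) * K (B4Sect5Torus.rate K γ₀ c₀ δ₀ / 12)

/-- [folklore] -/
theorem epsW_nonneg (hK : ∀ a, 0 < a → 0 ≤ K a) {γ₀ c₀ δ₀ εb : ℝ} (hγ : 0 < γ₀) (hc : 0 < c₀)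
    (hδ : 0 < δ₀) (hεb : 0 ≤ εb) : 0 ≤ epsW K γ₀ c₀ δ₀ εb := by
  unfold epsW
  have h1 := B4Sect5Torus.rate_pos hK hγ hc.le hδ
  have := hK _ (half_pos h1)
  have := hK (B4Sect5Torus.rate K γ₀ c₀ δ₀ / 4) (by positivity)
  have := B4Sect5Torus.bigC_nonneg hK hγ hc.le hδ
  positivity

/-- **From (5.6)-data.**  `A` on the big carrier and `A_L` on the window both satisfy the placed (5.6) with
`(γ₀, c₀, δ₀)`; `A|_W − A_L` (the change of boundary condition, supported near the far set: `Shape.of_nearFar`)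
has shape `(εb, δ₀)`.  Then `G_L = A_L⁻¹`, `G = A⁻¹` and `(G_L − G|_W)` has shape `(epsW, δ₁/4)` —
`G_L − G|_W = (A_L⁻¹ − (A|_W)⁻¹) + ((A|_W)⁻¹ − A⁻¹|_W)`: second resolvent identity + (5.8) — and
`G_L² − (G²)|_W` has shape `(epsSq, δ₁/12)`, `δ₁ = rate K γ₀ c₀ δ₀` of `B4Sect5Torus` — B6 p. 238 *"the operator with
G′(□̃)² − G′² is small and an estimate has the factor e^{−δ₀M} because of the usual estimate of the type (1.12) [3]
connected with a change of a domain"*, B9 (3.97) *"the usual factors multiplied by e^{−2δ₀M}"* (the factor itself: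
`Shape.apply_le_of_depth`; the printed rates are NOT claimed, DIVERGENCE D-b06.18).
[cite: Balaban1984PropagatorsII, p.238 before (2.85)] [cite: Balaban1985BackgroundPropagators, (3.97) p.412] -/
theorem sq_sub_sq_window_of_hyp56 (hρ : IsPseudoDist ρ) (hβ : IsDepth ρ β) (hK : ∀ a, 0 < a → 0 ≤ K a)
    {γ₀ c₀ δ₀ εb : ℝ} (hγ : 0 < γ₀) (hc : 0 < c₀) (hδ : 0 < δ₀) (hεb : 0 ≤ εb)
    {pn : n → S} (hPn : Profile ρ pn K)
    {e : m → n} (he : Function.Injective e) (hfar : ∀ z, (¬ ∃ u, e u = z) → β (pn z) = 0)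
    {A : Matrix n n ℝ} (hA : Hyp56 (fun i j => ρ (pn i) (pn j)) A γ₀ c₀ δ₀)
    {Aw : Matrix m m ℝ} (hAw : Hyp56 (fun i j => ρ ((pn ∘ e) i) ((pn ∘ e) j)) Aw γ₀ c₀ δ₀)
    (hb : Shape ρ β (pn ∘ e) (pn ∘ e) εb δ₀ (A.submatrix e e - Aw)) :
    Shape ρ β (pn ∘ e) (pn ∘ e) (epsW K γ₀ c₀ δ₀ εb) (B4Sect5Torus.rate K γ₀ c₀ δ₀ / 4)
        (Aw⁻¹ - (A⁻¹).submatrix e e) ∧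
      Shape ρ β (pn ∘ e) (pn ∘ e) (epsSq K γ₀ c₀ δ₀ εb) (B4Sect5Torus.rate K γ₀ c₀ δ₀ / 12)
        (Aw⁻¹ * Aw⁻¹ - (A⁻¹ * A⁻¹).submatrix e e) := by
  set δ₁ := B4Sect5Torus.rate K γ₀ c₀ δ₀ with hδ₁
  have hδ₁pos : 0 < δ₁ := B4Sect5Torus.rate_pos hK hγ hc.le hδ
  have hδ₁δ₀ : δ₁ ≤ δ₀ := B4Sect5Torus.rate_le_delta0 K γ₀ c₀ hδ
  have hPm : Profile ρ (pn ∘ e) K := hPn.comp he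
  have h2γ : (0 : ℝ) ≤ 2 / γ₀ := by positivity
  have hAe := hyp56_submatrix hA he
  -- decays of the three inverses at rate δ₁
  have hG : Decay ρ pn pn (2 / γ₀) δ₁ A⁻¹ := Decay.inv_of_hyp56 hK hγ hc.le hδ hρ hPn hA
  have hGw : Decay ρ (pn ∘ e) (pn ∘ e) (2 / γ₀) δ₁ Aw⁻¹ := Decay.inv_of_hyp56 hK hγ hc.le hδ hρ hPm hAw
  have hGe : Decay ρ (pn ∘ e) (pn ∘ e) (2 / γ₀) δ₁ (A.submatrix e e)⁻¹ :=
    Decay.inv_of_hyp56 hK hγ hc.le hδ hρ hPm hAe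
  -- the (1.12)-input
  have hX := Shape.inv_sub_inv hρ hβ hPm hδ₁pos hεb h2γ h2γ hK
    (B4Sect5Torus.isUnit_of_hyp56 hγ hAw) (B4Sect5Torus.isUnit_of_hyp56 hγ hAe) hGw hGe
    (hb.mono hρ hβ hεb le_rfl hδ₁δ₀)
  have hY := Shape.of_hyp56_compress hK hγ hc hδ hρ hβ hPn hA he hfar
  have hWs : Shape ρ β (pn ∘ e) (pn ∘ e) (epsW K γ₀ c₀ δ₀ εb) (δ₁ / 4) (Aw⁻¹ - (A⁻¹).submatrix e e) := by
    have e1 : Aw⁻¹ - (A⁻¹).submatrix e e =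
        (Aw⁻¹ - (A.submatrix e e)⁻¹) + ((A.submatrix e e)⁻¹ - (A⁻¹).submatrix e e) := by abel
    rw [e1]
    exact hX.add hY
  refine ⟨hWs, ?_⟩
  have hq : 0 < δ₁ / 4 := by positivity
  have h := sq_sub_sq_window hρ hβ hK hPn he hfar hq h2γ (epsW_nonneg hK hγ hc hδ hεb)
    (hG.mono hρ h2γ le_rfl (by linarith)) (hGw.mono hρ h2γ le_rfl (by linarith)) hWs
  rw [show δ₁ / 4 / 3 = δ₁ / 12 by ring, show δ₁ / 4 / 2 = δ₁ / 8 by ring] at h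
  unfold epsSq
  exact h

omit [Fintype m] [DecidableEq m] in
/-- **Deep evaluation** (the printed use): between points of depth `≥ M` the difference carries `e^{−2δ′M}`, and
`e^{−2δ′M} ≤ (2δ′M)⁻¹` — B9 p. 412 *"the distance from □̃ to □̃₀ᶜ is at least M … This exponential can be
estimated by (2δ₀M)⁻¹"* (printed rate `2δ₀`; here `δ′` is whatever rate the shape carries).
[cite: Balaban1985BackgroundPropagators, p.412] -/
theorem Shape.apply_le_of_depth {pl : l → S} {pm : m → S} {ε δ M : ℝ} {D : Matrix l m ℝ}
    (h : Shape ρ β pl pm ε δ D) (hε : 0 ≤ ε) (hδ : 0 < δ) (hM : 0 < M) {i : l} {j : m}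
    (hi : M ≤ β (pl i)) (hj : M ≤ β (pm j)) :
    |D i j| ≤ ε * Real.exp (-(2 * δ * M)) * Real.exp (-(δ * ρ (pl i) (pm j))) ∧
      |D i j| ≤ ε * (2 * δ * M)⁻¹ * Real.exp (-(δ * ρ (pl i) (pm j))) := by
  have h1 := h.apply_le hε hδ.le hi hj
  rw [show δ * (M + M) = 2 * δ * M by ring] at h1
  refine ⟨h1, h1.trans ?_⟩
  apply mul_le_mul_of_nonneg_right _ (Real.exp_pos _).le
  -- `e^{−x} ≤ x⁻¹` (landed as `Literature.Barriers.RiemannHypothesis.Hamburger1921.exp_neg_le_inv`; two lines here)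
  have hx : (0 : ℝ) < 2 * δ * M := by positivity
  have : Real.exp (-(2 * δ * M)) ≤ (2 * δ * M)⁻¹ := by
    rw [Real.exp_neg]; exact inv_anti₀ hx (by linarith [Real.add_one_le_exp (2 * δ * M)])
  exact mul_le_mul_of_nonneg_left this hε

end Square

/-! ## §B  Two carriers agreeing on a window (P on 𝔅 against P_□ on the torus T_□, B6 (2.92)/(2.134)):
window agreement is stable under products, transposition and inversion -/

section TwoCarriers

/-- transport of a shape along equal position maps [folklore] -/
theorem Shape.pos_congr {pl pl' : l → S} {pm pm' : m → S} {ε δ : ℝ} {D : Matrix l m ℝ}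
    (h : Shape ρ β pl pm ε δ D) (hl : pl = pl') (hm : pm = pm') : Shape ρ β pl' pm' ε δ D := by
  subst hl; subst hm; exact h

/-- [folklore] -/
theorem Decay.pos_congr {pl pl' : l → S} {pm pm' : m → S} {c δ : ℝ} {A : Matrix l m ℝ}
    (h : Decay ρ pl pm c δ A) (hl : pl = pl') (hm : pm = pm') : Decay ρ pl' pm' c δ A := by
  subst hl; subst hm; exact h

/-- the zero depth is a depth: `Decay` is `Shape` with `β = 0` [folklore] -/
theorem isDepth_zero (hρ : IsPseudoDist ρ) : IsDepth ρ (fun _ : S => (0 : ℝ)) :=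
  ⟨fun _ => le_rfl, fun s t => by have := hρ.nonneg s t; linarith⟩

/-- [folklore] -/
theorem Decay.toShape_zero {pl : l → S} {pm : m → S} {c δ : ℝ} {A : Matrix l m ℝ}
    (h : Decay ρ pl pm c δ A) : Shape ρ (fun _ : S => (0 : ℝ)) pl pm c δ A := fun i j => by
  simpa using h i j

/-- [folklore] -/
theorem Shape.toDecay_zero {pl : l → S} {pm : m → S} {c δ : ℝ} {A : Matrix l m ℝ}
    (h : Shape ρ (fun _ : S => (0 : ℝ)) pl pm c δ A) : Decay ρ pl pm c δ A := fun i j => by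
  simpa using h i j

/-- a product of decaying kernels decays (half the rate pays for the middle sum) [folklore] -/
theorem Decay.mul [Fintype m] (hρ : IsPseudoDist ρ) {pl : l → S} {pm : m → S} {pk : k → S}
    (hP : Profile ρ pm K) {cX cY δ : ℝ} (hδ : 0 < δ) (hcX : 0 ≤ cX) (hcY : 0 ≤ cY)
    {X : Matrix l m ℝ} {Y : Matrix m k ℝ} (hX : Decay ρ pl pm cX δ X) (hY : Decay ρ pm pk cY δ Y) :
    Decay ρ pl pk (cX * cY * K (δ / 2)) (δ / 2) (X * Y) :=
  (hX.toShape_zero.mul_right hρ (isDepth_zero hρ) hP hδ hcX hcY hY).toDecay_zero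

variable {l₁ n₁ k₁ l₂ n₂ k₂ l' k' : Type*}
variable [Fintype n₁] [DecidableEq n₁] [Fintype n₂] [DecidableEq n₂] [Fintype m] [DecidableEq m]

omit [DecidableEq m] in
/-- **Window agreement is stable under products.**  Two carriers, `X_c Y_c` on each; on the common window the
compressions of the factors agree up to shapes `(εX, δ)`, `(εY, δ)`; then the compressions of the products agree
up to the shape `((εX·cY + cX·εY)K(δ/2) + 2cXcY·K(δ/3), δ/3)` — congruence of the window products plus one
defect through the far set per carrier. [folklore] -/
theorem wa_mul (hρ : IsPseudoDist ρ) (hβ : IsDepth ρ β) (hK : ∀ a, 0 < a → 0 ≤ K a)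
    {pl₁ : l₁ → S} {pn₁ : n₁ → S} {pk₁ : k₁ → S} {pl₂ : l₂ → S} {pn₂ : n₂ → S} {pk₂ : k₂ → S}
    {plw : l' → S} {pmw : m → S} {pkw : k' → S}
    {fl₁ : l' → l₁} {e₁ : m → n₁} {fk₁ : k' → k₁} {fl₂ : l' → l₂} {e₂ : m → n₂} {fk₂ : k' → k₂}
    (hl₁ : pl₁ ∘ fl₁ = plw) (hm₁ : pn₁ ∘ e₁ = pmw) (hk₁ : pk₁ ∘ fk₁ = pkw)
    (hl₂ : pl₂ ∘ fl₂ = plw) (hm₂ : pn₂ ∘ e₂ = pmw) (hk₂ : pk₂ ∘ fk₂ = pkw)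
    (he₁ : Function.Injective e₁) (he₂ : Function.Injective e₂)
    (hfar₁ : ∀ z, (¬ ∃ u, e₁ u = z) → β (pn₁ z) = 0) (hfar₂ : ∀ z, (¬ ∃ u, e₂ u = z) → β (pn₂ z) = 0)
    (hP₁ : Profile ρ pn₁ K) (hP₂ : Profile ρ pn₂ K)
    {cX cY εX εY δ : ℝ} (hδ : 0 < δ) (hcX : 0 ≤ cX) (hcY : 0 ≤ cY) (hεX : 0 ≤ εX) (hεY : 0 ≤ εY)
    {X₁ : Matrix l₁ n₁ ℝ} {Y₁ : Matrix n₁ k₁ ℝ} {X₂ : Matrix l₂ n₂ ℝ} {Y₂ : Matrix n₂ k₂ ℝ}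
    (hX₁ : Decay ρ pl₁ pn₁ cX δ X₁) (hX₂ : Decay ρ pl₂ pn₂ cX δ X₂)
    (hY₁ : Decay ρ pn₁ pk₁ cY δ Y₁) (hY₂ : Decay ρ pn₂ pk₂ cY δ Y₂)
    (hX : Shape ρ β plw pmw εX δ (X₁.submatrix fl₁ e₁ - X₂.submatrix fl₂ e₂))
    (hY : Shape ρ β pmw pkw εY δ (Y₁.submatrix e₁ fk₁ - Y₂.submatrix e₂ fk₂)) :
    Shape ρ β plw pkw ((εX * cY + cX * εY) * K (δ / 2) + 2 * (cX * cY * K (δ / 3))) (δ / 3)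
      ((X₁ * Y₁).submatrix fl₁ fk₁ - (X₂ * Y₂).submatrix fl₂ fk₂) := by
  have hPw : Profile ρ pmw K := hm₁ ▸ hP₁.comp he₁
  have h1 := Shape.mul_congr hρ hβ hPw hδ hεX hεY hcX hcY hX hY
    ((hX₂.submatrix fl₂ e₂).pos_congr hl₂ hm₂) ((hY₁.submatrix e₁ fk₁).pos_congr hm₁ hk₁)
  have h1' := h1.mono hρ hβ (by have := hK _ (half_pos hδ); positivity) le_rfl
    (by linarith : δ / 3 ≤ δ / 2)
  have hd₁ := (defect_shape hρ hβ hP₁ hδ hcX hcY hX₁ hY₁ hfar₁ fl₁ fk₁).pos_congr hl₁ hk₁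
  have hd₂ := (defect_shape hρ hβ hP₂ hδ hcX hcY hX₂ hY₂ hfar₂ fl₂ fk₂).pos_congr hl₂ hk₂
  have e1 : (X₁ * Y₁).submatrix fl₁ fk₁ - (X₂ * Y₂).submatrix fl₂ fk₂ =
      (X₁.submatrix fl₁ e₁ * Y₁.submatrix e₁ fk₁ - X₂.submatrix fl₂ e₂ * Y₂.submatrix e₂ fk₂) +
        (defect e₁ X₁ Y₁ fl₁ fk₁ - defect e₂ X₂ Y₂ fl₂ fk₂) := by
    rw [submatrix_mul X₁ Y₁ he₁ fl₁ fk₁, submatrix_mul X₂ Y₂ he₂ fl₂ fk₂]; abel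
  rw [e1, show (εX * cY + cX * εY) * K (δ / 2) + 2 * (cX * cY * K (δ / 3)) =
    (εX * cY + cX * εY) * K (δ / 2) + (cX * cY * K (δ / 3) + cX * cY * K (δ / 3)) by ring]
  exact h1'.add (hd₁.sub hd₂)

omit [Fintype n₁] [DecidableEq n₁] [Fintype n₂] [DecidableEq n₂] [Fintype m] [DecidableEq m] in
/-- **Window agreement is stable under transposition.** [folklore] -/
theorem wa_transpose (hρ : IsPseudoDist ρ) {plw : l' → S} {pkw : k' → S}
    {fl₁ : l' → l₁} {fk₁ : k' → k₁} {fl₂ : l' → l₂} {fk₂ : k' → k₂} {ε δ : ℝ}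
    {X₁ : Matrix l₁ k₁ ℝ} {X₂ : Matrix l₂ k₂ ℝ}
    (hX : Shape ρ β plw pkw ε δ (X₁.submatrix fl₁ fk₁ - X₂.submatrix fl₂ fk₂)) :
    Shape ρ β pkw plw ε δ (X₁.transpose.submatrix fk₁ fl₁ - X₂.transpose.submatrix fk₂ fl₂) := by
  have h := hX.transpose hρ
  intro i j
  have := h i j
  simpa [Matrix.transpose_apply, Matrix.sub_apply, Matrix.submatrix_apply] using this

/-- **Window agreement is stable under inversion** (square kernels with the placed (5.6) on each carrier):
`X₁⁻¹|_W − X₂⁻¹|_W = (X₁⁻¹|_W − (X₁|_W)⁻¹) + ((X₁|_W)⁻¹ − (X₂|_W)⁻¹) + ((X₂|_W)⁻¹ − X₂⁻¹|_W)`: (5.8) on each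
carrier and the second resolvent identity on the window. [cite: Balaban1983RegularityDecay, (5.8) + (5.10) p.594] -/
theorem wa_inv (hρ : IsPseudoDist ρ) (hβ : IsDepth ρ β) (hK : ∀ a, 0 < a → 0 ≤ K a)
    {γ c₀ δ₀ : ℝ} (hγ : 0 < γ) (hc : 0 < c₀) (hδ₀ : 0 < δ₀)
    {pn₁ : n₁ → S} {pn₂ : n₂ → S} {pmw : m → S} {e₁ : m → n₁} {e₂ : m → n₂}
    (hm₁ : pn₁ ∘ e₁ = pmw) (hm₂ : pn₂ ∘ e₂ = pmw)
    (he₁ : Function.Injective e₁) (he₂ : Function.Injective e₂)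
    (hfar₁ : ∀ z, (¬ ∃ u, e₁ u = z) → β (pn₁ z) = 0) (hfar₂ : ∀ z, (¬ ∃ u, e₂ u = z) → β (pn₂ z) = 0)
    (hP₁ : Profile ρ pn₁ K) (hP₂ : Profile ρ pn₂ K)
    {X₁ : Matrix n₁ n₁ ℝ} {X₂ : Matrix n₂ n₂ ℝ}
    (hX₁ : Hyp56 (fun i j => ρ (pn₁ i) (pn₁ j)) X₁ γ c₀ δ₀)
    (hX₂ : Hyp56 (fun i j => ρ (pn₂ i) (pn₂ j)) X₂ γ c₀ δ₀)
    {εX δX : ℝ} (hεX : 0 ≤ εX) (hδX : 0 < δX) (hδX1 : δX ≤ B4Sect5Torus.rate K γ c₀ δ₀)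
    (hX : Shape ρ β pmw pmw εX δX (X₁.submatrix e₁ e₁ - X₂.submatrix e₂ e₂)) :
    Shape ρ β pmw pmw
      (B4Sect5Torus.bigC K γ c₀ δ₀ + 2 / γ * εX * K (δX / 2) * (2 / γ) * K (δX / 4) +
        B4Sect5Torus.bigC K γ c₀ δ₀) (δX / 4)
      ((X₁⁻¹).submatrix e₁ e₁ - (X₂⁻¹).submatrix e₂ e₂) := by
  set δ₁ := B4Sect5Torus.rate K γ c₀ δ₀ with hδ₁
  have hbig : 0 ≤ B4Sect5Torus.bigC K γ c₀ δ₀ := B4Sect5Torus.bigC_nonneg hK hγ hc.le hδ₀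
  have h2γ : (0 : ℝ) ≤ 2 / γ := by positivity
  have hPw : Profile ρ pmw K := hm₁ ▸ hP₁.comp he₁
  have hX₁e := hyp56_submatrix hX₁ he₁
  have hX₂e := hyp56_submatrix hX₂ he₂
  -- T1, T3 : (5.8) on each carrier
  have hT1 : Shape ρ β pmw pmw (B4Sect5Torus.bigC K γ c₀ δ₀) (δX / 4)
      ((X₁⁻¹).submatrix e₁ e₁ - (X₁.submatrix e₁ e₁)⁻¹) :=
    (((Shape.of_hyp56_compress hK hγ hc hδ₀ hρ hβ hP₁ hX₁ he₁ hfar₁).pos_congr hm₁ hm₁).mono hρ hβ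
      hbig le_rfl (by linarith)).of_eq_symm
  have hT3 : Shape ρ β pmw pmw (B4Sect5Torus.bigC K γ c₀ δ₀) (δX / 4)
      ((X₂.submatrix e₂ e₂)⁻¹ - (X₂⁻¹).submatrix e₂ e₂) :=
    ((Shape.of_hyp56_compress hK hγ hc hδ₀ hρ hβ hP₂ hX₂ he₂ hfar₂).pos_congr hm₂ hm₂).mono hρ hβ
      hbig le_rfl (by linarith)
  -- T2 : second resolvent identity on the window
  have hi₁ : Decay ρ pmw pmw (2 / γ) δX (X₁.submatrix e₁ e₁)⁻¹ :=
    ((Decay.inv_of_hyp56 hK hγ hc.le hδ₀ hρ (hP₁.comp he₁) hX₁e).pos_congr hm₁ hm₁).mono hρ h2γ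
      le_rfl hδX1
  have hi₂ : Decay ρ pmw pmw (2 / γ) δX (X₂.submatrix e₂ e₂)⁻¹ :=
    ((Decay.inv_of_hyp56 hK hγ hc.le hδ₀ hρ (hP₂.comp he₂) hX₂e).pos_congr hm₂ hm₂).mono hρ h2γ
      le_rfl hδX1
  have hT2 := Shape.inv_sub_inv hρ hβ hPw hδX hεX h2γ h2γ hK
    (B4Sect5Torus.isUnit_of_hyp56 hγ hX₁e) (B4Sect5Torus.isUnit_of_hyp56 hγ hX₂e) hi₁ hi₂ hX.of_eq_symm
  have e1 : (X₁⁻¹).submatrix e₁ e₁ - (X₂⁻¹).submatrix e₂ e₂ =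
      ((X₁⁻¹).submatrix e₁ e₁ - (X₁.submatrix e₁ e₁)⁻¹) +
        ((X₁.submatrix e₁ e₁)⁻¹ - (X₂.submatrix e₂ e₂)⁻¹) +
        ((X₂.submatrix e₂ e₂)⁻¹ - (X₂⁻¹).submatrix e₂ e₂) := by abel
  rw [e1]
  exact (hT1.add hT2).add hT3

end TwoCarriers

/-! ## §C  Application 2 — the projection `P = G′Q′*(Q′G′²Q′*)⁻¹Q′G′` built on two carriers that agree on a
window: `P|_W − P_□|_W` has the (1.12)-shape (B6 (2.92) *"ζ_□(∂P∂* − ∂P_□∂*)h_□"*, G-B6-11 (a)) -/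

section ProjectionConstants

variable (K : ℝ → ℝ) (γ₀ c₀ δ₀ cQ γB : ℝ)

/-- working rate on the fine lattice: a quarter of the (5.7)-rate `δ₁` of `Δ′_a` OURS. [folklore] -/
noncomputable def rA : ℝ := B4Sect5Torus.rate K γ₀ c₀ δ₀ / 4
/-- window discrepancy of `G = (Δ′_a)⁻¹` (exact agreement of `Δ′_a` on the window; `wa_inv` with `εX = 0`) OURS. [folklore] -/
noncomputable def epsG : ℝ :=
  B4Sect5Torus.bigC K γ₀ c₀ δ₀ +
    2 / γ₀ * 0 * K (B4Sect5Torus.rate K γ₀ c₀ δ₀ / 2) * (2 / γ₀) * K (B4Sect5Torus.rate K γ₀ c₀ δ₀ / 4) +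
    B4Sect5Torus.bigC K γ₀ c₀ δ₀
/-- window discrepancy of `V = Q′G′` OURS. [folklore] -/
noncomputable def epsV : ℝ :=
  (0 * (2 / γ₀) + cQ * epsG K γ₀ c₀ δ₀) * K (rA K γ₀ c₀ δ₀ / 2) +
    2 * (cQ * (2 / γ₀) * K (rA K γ₀ c₀ δ₀ / 3))
/-- decay constant of `V = Q′G′` OURS. [folklore] -/
noncomputable def cV : ℝ := cQ * (2 / γ₀) * K (rA K γ₀ c₀ δ₀ / 2)
/-- window discrepancy of `B = VVᵀ = Q′G′²Q′*` OURS. [folklore] -/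
noncomputable def epsB : ℝ :=
  (epsV K γ₀ c₀ δ₀ cQ * cV K γ₀ c₀ δ₀ cQ + cV K γ₀ c₀ δ₀ cQ * epsV K γ₀ c₀ δ₀ cQ) *
      K (rA K γ₀ c₀ δ₀ / 3 / 2) +
    2 * (cV K γ₀ c₀ δ₀ cQ * cV K γ₀ c₀ δ₀ cQ * K (rA K γ₀ c₀ δ₀ / 3 / 3))
/-- DERIVED kernel-bound constant of `B = VVᵀ = Q′G′²Q′*` (its (5.6) needs only the coercivity as an input) OURS. [folklore] -/
noncomputable def cB : ℝ := cV K γ₀ c₀ δ₀ cQ * cV K γ₀ c₀ δ₀ cQ * K (rA K γ₀ c₀ δ₀ / 3 / 2) + 1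
/-- DERIVED decay rate of `B = VVᵀ` OURS. [folklore] -/
noncomputable def dB : ℝ := rA K γ₀ c₀ δ₀ / 3 / 2
/-- working rate on the coarse lattice: `min(rA/9, δ₁ᴮ)`, `δ₁ᴮ = rate K γB cB dB` the (5.7)-rate of `Q′G′²Q′*` OURS. [folklore] -/
noncomputable def rB : ℝ :=
  min (rA K γ₀ c₀ δ₀ / 9) (B4Sect5Torus.rate K γB (cB K γ₀ c₀ δ₀ cQ) (dB K γ₀ c₀ δ₀))
/-- window discrepancy of `N = B⁻¹` OURS. [folklore] -/
noncomputable def epsN : ℝ :=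
  B4Sect5Torus.bigC K γB (cB K γ₀ c₀ δ₀ cQ) (dB K γ₀ c₀ δ₀) +
    2 / γB * epsB K γ₀ c₀ δ₀ cQ * K (rB K γ₀ c₀ δ₀ cQ γB / 2) * (2 / γB) *
      K (rB K γ₀ c₀ δ₀ cQ γB / 4) +
    B4Sect5Torus.bigC K γB (cB K γ₀ c₀ δ₀ cQ) (dB K γ₀ c₀ δ₀)
/-- window discrepancy of `U = NV` OURS. [folklore] -/
noncomputable def epsU : ℝ :=
  (epsN K γ₀ c₀ δ₀ cQ γB * cV K γ₀ c₀ δ₀ cQ + 2 / γB * epsV K γ₀ c₀ δ₀ cQ) *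
      K (rB K γ₀ c₀ δ₀ cQ γB / 4 / 2) +
    2 * (2 / γB * cV K γ₀ c₀ δ₀ cQ * K (rB K γ₀ c₀ δ₀ cQ γB / 4 / 3))
/-- decay constant of `U = NV` OURS. [folklore] -/
noncomputable def cU : ℝ := 2 / γB * cV K γ₀ c₀ δ₀ cQ * K (rB K γ₀ c₀ δ₀ cQ γB / 4 / 2)
/-- **window discrepancy of `P = VᵀU = G′Q′*(Q′G′²Q′*)⁻¹Q′G′`** — the constant of `projection_window_agree`,
an explicit function of the structural constants only (this is the geometry-uniform O(1) behind B6 (2.92)/(2.134)).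
[cite: Balaban1984PropagatorsII, (2.134) p.247] -/
noncomputable def epsP : ℝ :=
  (epsV K γ₀ c₀ δ₀ cQ * cU K γ₀ c₀ δ₀ cQ γB + cV K γ₀ c₀ δ₀ cQ * epsU K γ₀ c₀ δ₀ cQ γB) *
      K (rB K γ₀ c₀ δ₀ cQ γB / 4 / 3 / 2) +
    2 * (cV K γ₀ c₀ δ₀ cQ * cU K γ₀ c₀ δ₀ cQ γB * K (rB K γ₀ c₀ δ₀ cQ γB / 4 / 3 / 3))
/-- **the rate of `projection_window_agree`**: `rB/36` — B6 p. 238: *"δ₂ is determined by δ₀, δ₁"*.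
[cite: Balaban1984PropagatorsII, (2.88) p.238] -/
noncomputable def deltaP : ℝ := rB K γ₀ c₀ δ₀ cQ γB / 4 / 3 / 3

variable {K γ₀ c₀ δ₀ cQ γB}

/-- [folklore] -/
theorem rA_pos (hK : ∀ a, 0 < a → 0 ≤ K a) (hγ : 0 < γ₀) (hc : 0 < c₀) (hδ : 0 < δ₀) : 0 < rA K γ₀ c₀ δ₀ := by
  unfold rA; have := B4Sect5Torus.rate_pos hK hγ hc.le hδ; positivity

/-- [folklore] -/
theorem rA_le (hK : ∀ a, 0 < a → 0 ≤ K a) (hγ : 0 < γ₀) (hc : 0 < c₀) (hδ : 0 < δ₀) :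
    rA K γ₀ c₀ δ₀ ≤ B4Sect5Torus.rate K γ₀ c₀ δ₀ := by
  unfold rA; have := B4Sect5Torus.rate_pos hK hγ hc.le hδ; linarith

/-- [folklore] -/
theorem epsG_nonneg (hK : ∀ a, 0 < a → 0 ≤ K a) (hγ : 0 < γ₀) (hc : 0 < c₀) (hδ : 0 < δ₀) :
    0 ≤ epsG K γ₀ c₀ δ₀ := by
  unfold epsG
  have := B4Sect5Torus.bigC_nonneg hK hγ hc.le hδ
  have h1 := B4Sect5Torus.rate_pos hK hγ hc.le hδ
  have := hK (B4Sect5Torus.rate K γ₀ c₀ δ₀ / 2) (by positivity)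
  have := hK (B4Sect5Torus.rate K γ₀ c₀ δ₀ / 4) (by positivity)
  positivity

/-- [folklore] -/
theorem cV_nonneg (hK : ∀ a, 0 < a → 0 ≤ K a) (hγ : 0 < γ₀) (hc : 0 < c₀) (hδ : 0 < δ₀) (hcQ : 0 ≤ cQ) :
    0 ≤ cV K γ₀ c₀ δ₀ cQ := by
  unfold cV
  have h1 := rA_pos hK hγ hc hδ
  have := hK (rA K γ₀ c₀ δ₀ / 2) (by positivity)
  positivity

/-- [folklore] -/
theorem epsV_nonneg (hK : ∀ a, 0 < a → 0 ≤ K a) (hγ : 0 < γ₀) (hc : 0 < c₀) (hδ : 0 < δ₀) (hcQ : 0 ≤ cQ) :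
    0 ≤ epsV K γ₀ c₀ δ₀ cQ := by
  unfold epsV
  have h1 := rA_pos hK hγ hc hδ
  have := epsG_nonneg hK hγ hc hδ
  have := hK (rA K γ₀ c₀ δ₀ / 2) (by positivity)
  have := hK (rA K γ₀ c₀ δ₀ / 3) (by positivity)
  positivity

/-- [folklore] -/
theorem epsB_nonneg (hK : ∀ a, 0 < a → 0 ≤ K a) (hγ : 0 < γ₀) (hc : 0 < c₀) (hδ : 0 < δ₀) (hcQ : 0 ≤ cQ) :
    0 ≤ epsB K γ₀ c₀ δ₀ cQ := by
  unfold epsB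
  have h1 := rA_pos hK hγ hc hδ
  have := epsV_nonneg hK hγ hc hδ hcQ
  have := cV_nonneg hK hγ hc hδ hcQ
  have := hK (rA K γ₀ c₀ δ₀ / 3 / 2) (by positivity)
  have := hK (rA K γ₀ c₀ δ₀ / 3 / 3) (by positivity)
  positivity

/-- [folklore] -/
theorem cB_pos (hK : ∀ a, 0 < a → 0 ≤ K a) (hγ : 0 < γ₀) (hc : 0 < c₀) (hδ : 0 < δ₀) (hcQ : 0 ≤ cQ) :
    0 < cB K γ₀ c₀ δ₀ cQ := by
  unfold cB
  have h1 := rA_pos hK hγ hc hδ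
  have := cV_nonneg hK hγ hc hδ hcQ
  have := hK (rA K γ₀ c₀ δ₀ / 3 / 2) (by positivity)
  positivity

/-- [folklore] -/
theorem dB_pos (hK : ∀ a, 0 < a → 0 ≤ K a) (hγ : 0 < γ₀) (hc : 0 < c₀) (hδ : 0 < δ₀) : 0 < dB K γ₀ c₀ δ₀ := by
  unfold dB; have := rA_pos hK hγ hc hδ; positivity

/-- [folklore] -/
theorem rB_pos (hK : ∀ a, 0 < a → 0 ≤ K a) (hγ : 0 < γ₀) (hc : 0 < c₀) (hδ : 0 < δ₀) (hcQ' : 0 ≤ cQ) (hγB : 0 < γB) : 0 < rB K γ₀ c₀ δ₀ cQ γB := by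
  unfold rB
  exact lt_min (by have := rA_pos hK hγ hc hδ; positivity) (B4Sect5Torus.rate_pos hK hγB (cB_pos hK hγ hc hδ hcQ').le (dB_pos hK hγ hc hδ))

/-- [folklore] -/
theorem rB_le_rA : rB K γ₀ c₀ δ₀ cQ γB ≤ rA K γ₀ c₀ δ₀ / 9 := min_le_left _ _

/-- [folklore] -/
theorem rB_le_rate : rB K γ₀ c₀ δ₀ cQ γB ≤ B4Sect5Torus.rate K γB (cB K γ₀ c₀ δ₀ cQ) (dB K γ₀ c₀ δ₀) := min_le_right _ _

/-- the rate of `projection_window_agree` is positive [folklore] -/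
theorem deltaP_pos (hK : ∀ a, 0 < a → 0 ≤ K a) (hγ : 0 < γ₀) (hc : 0 < c₀) (hδ : 0 < δ₀) (hcQ' : 0 ≤ cQ) (hγB : 0 < γB) : 0 < deltaP K γ₀ c₀ δ₀ cQ γB := by
  unfold deltaP; have := rB_pos hK hγ hc hδ hcQ' hγB; positivity

/-- [folklore] -/
theorem epsN_nonneg (hK : ∀ a, 0 < a → 0 ≤ K a) (hγ : 0 < γ₀) (hc : 0 < c₀) (hδ : 0 < δ₀) (hcQ : 0 ≤ cQ)
    (hγB : 0 < γB) : 0 ≤ epsN K γ₀ c₀ δ₀ cQ γB := by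
  unfold epsN
  have h1 := rB_pos hK hγ hc hδ hcQ hγB
  have := epsB_nonneg hK hγ hc hδ hcQ
  have := B4Sect5Torus.bigC_nonneg hK hγB (cB_pos hK hγ hc hδ hcQ).le (dB_pos hK hγ hc hδ)
  have := hK (rB K γ₀ c₀ δ₀ cQ γB / 2) (by positivity)
  have := hK (rB K γ₀ c₀ δ₀ cQ γB / 4) (by positivity)
  positivity

/-- [folklore] -/
theorem cU_nonneg (hK : ∀ a, 0 < a → 0 ≤ K a) (hγ : 0 < γ₀) (hc : 0 < c₀) (hδ : 0 < δ₀) (hcQ : 0 ≤ cQ)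
    (hγB : 0 < γB) : 0 ≤ cU K γ₀ c₀ δ₀ cQ γB := by
  unfold cU
  have h1 := rB_pos hK hγ hc hδ hcQ hγB
  have := cV_nonneg hK hγ hc hδ hcQ
  have := hK (rB K γ₀ c₀ δ₀ cQ γB / 4 / 2) (by positivity)
  positivity

/-- [folklore] -/
theorem epsU_nonneg (hK : ∀ a, 0 < a → 0 ≤ K a) (hγ : 0 < γ₀) (hc : 0 < c₀) (hδ : 0 < δ₀) (hcQ : 0 ≤ cQ)
    (hγB : 0 < γB) : 0 ≤ epsU K γ₀ c₀ δ₀ cQ γB := by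
  unfold epsU
  have h1 := rB_pos hK hγ hc hδ hcQ hγB
  have := epsN_nonneg hK hγ hc hδ hcQ hγB
  have := epsV_nonneg hK hγ hc hδ hcQ
  have := cV_nonneg hK hγ hc hδ hcQ
  have := hK (rB K γ₀ c₀ δ₀ cQ γB / 4 / 2) (by positivity)
  have := hK (rB K γ₀ c₀ δ₀ cQ γB / 4 / 3) (by positivity)
  positivity

end ProjectionConstants

section Projection

variable {n₁ q₁ n₂ q₂ w : Type*}
variable [Fintype n₁] [DecidableEq n₁] [Fintype q₁] [DecidableEq q₁]
variable [Fintype n₂] [DecidableEq n₂] [Fintype q₂] [DecidableEq q₂]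
variable [Fintype m] [DecidableEq m] [Fintype w] [DecidableEq w]

/-- **Application 2 (G-B6-11 (a); B6 (2.92), (2.134)).**  Two carriers — `𝔅` (index types `n₁ ⊃_e₁ m`,
`q₁ ⊃_f₁ w`) and the torus `T_□` (`n₂ ⊃_e₂ m`, `q₂ ⊃_f₂ w`) — carry `Δ′_a`-type operators `A_c` with the placed
(5.6) `(γ₀, c₀, δ₀)`, averaging operators `Q_c` with off-diagonal decay `(cQ, δ₀)`, and `B_c = Q_cG_c²Q_c*`,
`G_c = A_c⁻¹`, whose quadratic forms are bounded below by `γB` (the printed coercivity (2.78); the rest of the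
(5.6) of `B_c` — symmetry and the kernel bound `(cB, dB)` — is DERIVED here from that of `A_c` and the decay of
`Q_c`, as on B6 pp. 236–237).  If `A₁, A₂` agree on the window `m` (B6 p. 238: *"We take the cube □̃³ and identify it with a torus"*), `Q₁, Q₂` agree on
`w × m`, and the depth `β` vanishes off the windows, then the compressions of
`P_c = G_cQ_c*(Q_cG_c²Q_c*)⁻¹Q_cG_c` (here in the form `VᵀB⁻¹V`, `V = QG`, `B = VVᵀ`; for symmetric `G` this is the
printed `P`, see `transpose_mul_inv_eq`) differ by a kernel of the (1.12)-shape with the explicit constants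
`(epsP, deltaP)` — functions of the structural constants only.  Eleven applications of §B.
[cite: Balaban1984PropagatorsII, (2.92) p.239 + (2.134) p.247] -/
theorem projection_window_agree (hρ : IsPseudoDist ρ) (hβ : IsDepth ρ β) (hK : ∀ a, 0 < a → 0 ≤ K a)
    {γ₀ c₀ δ₀ cQ γB : ℝ} (hγ : 0 < γ₀) (hc : 0 < c₀) (hδ : 0 < δ₀) (hcQ : 0 ≤ cQ) (hγB : 0 < γB)
    {pn₁ : n₁ → S} {pq₁ : q₁ → S} {pn₂ : n₂ → S} {pq₂ : q₂ → S} {pmw : m → S} {pww : w → S}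
    {e₁ : m → n₁} {f₁ : w → q₁} {e₂ : m → n₂} {f₂ : w → q₂}
    (hm₁ : pn₁ ∘ e₁ = pmw) (hw₁ : pq₁ ∘ f₁ = pww) (hm₂ : pn₂ ∘ e₂ = pmw) (hw₂ : pq₂ ∘ f₂ = pww)
    (he₁ : Function.Injective e₁) (hf₁ : Function.Injective f₁)
    (he₂ : Function.Injective e₂) (hf₂ : Function.Injective f₂)
    (hfarn₁ : ∀ z, (¬ ∃ u, e₁ u = z) → β (pn₁ z) = 0) (hfarq₁ : ∀ y, (¬ ∃ u, f₁ u = y) → β (pq₁ y) = 0)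
    (hfarn₂ : ∀ z, (¬ ∃ u, e₂ u = z) → β (pn₂ z) = 0) (hfarq₂ : ∀ y, (¬ ∃ u, f₂ u = y) → β (pq₂ y) = 0)
    (hPn₁ : Profile ρ pn₁ K) (hPq₁ : Profile ρ pq₁ K) (hPn₂ : Profile ρ pn₂ K) (hPq₂ : Profile ρ pq₂ K)
    {A₁ : Matrix n₁ n₁ ℝ} {Q₁ : Matrix q₁ n₁ ℝ} {A₂ : Matrix n₂ n₂ ℝ} {Q₂ : Matrix q₂ n₂ ℝ}
    (hA₁ : Hyp56 (fun i j => ρ (pn₁ i) (pn₁ j)) A₁ γ₀ c₀ δ₀)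
    (hA₂ : Hyp56 (fun i j => ρ (pn₂ i) (pn₂ j)) A₂ γ₀ c₀ δ₀)
    (hQ₁ : Decay ρ pq₁ pn₁ cQ δ₀ Q₁) (hQ₂ : Decay ρ pq₂ pn₂ cQ δ₀ Q₂)
    (hcoer₁ : ∀ v : q₁ → ℝ,
      γB * ∑ p, v p ^ 2 ≤ ∑ p, v p * (Q₁ * A₁⁻¹ * (Q₁ * A₁⁻¹).transpose).mulVec v p)
    (hcoer₂ : ∀ v : q₂ → ℝ,
      γB * ∑ p, v p ^ 2 ≤ ∑ p, v p * (Q₂ * A₂⁻¹ * (Q₂ * A₂⁻¹).transpose).mulVec v p)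
    (hAeq : A₁.submatrix e₁ e₁ = A₂.submatrix e₂ e₂) (hQeq : Q₁.submatrix f₁ e₁ = Q₂.submatrix f₂ e₂) :
    Shape ρ β pmw pmw (epsP K γ₀ c₀ δ₀ cQ γB) (deltaP K γ₀ c₀ δ₀ cQ γB)
      (((Q₁ * A₁⁻¹).transpose * ((Q₁ * A₁⁻¹ * (Q₁ * A₁⁻¹).transpose)⁻¹ * (Q₁ * A₁⁻¹))).submatrix e₁ e₁ -
        ((Q₂ * A₂⁻¹).transpose * ((Q₂ * A₂⁻¹ * (Q₂ * A₂⁻¹).transpose)⁻¹ * (Q₂ * A₂⁻¹))).submatrix e₂ e₂) := by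
  -- structural positivity facts (constants are atoms: `rA, rB, epsG, …`)
  have hδ₁pos : 0 < B4Sect5Torus.rate K γ₀ c₀ δ₀ := B4Sect5Torus.rate_pos hK hγ hc.le hδ
  have hδ₁δ₀ : B4Sect5Torus.rate K γ₀ c₀ δ₀ ≤ δ₀ := B4Sect5Torus.rate_le_delta0 K γ₀ c₀ hδ
  have hd : 0 < rA K γ₀ c₀ δ₀ := rA_pos hK hγ hc hδ
  have hd1 : rA K γ₀ c₀ δ₀ ≤ B4Sect5Torus.rate K γ₀ c₀ δ₀ := rA_le hK hγ hc hδ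
  have hcB : 0 < cB K γ₀ c₀ δ₀ cQ := cB_pos hK hγ hc hδ hcQ
  have hδB : 0 < dB K γ₀ c₀ δ₀ := dB_pos hK hγ hc hδ
  have hr : 0 < rB K γ₀ c₀ δ₀ cQ γB := rB_pos hK hγ hc hδ hcQ hγB
  have hrd : rB K γ₀ c₀ δ₀ cQ γB ≤ rA K γ₀ c₀ δ₀ / 9 := rB_le_rA
  have hrB : rB K γ₀ c₀ δ₀ cQ γB ≤ B4Sect5Torus.rate K γB (cB K γ₀ c₀ δ₀ cQ) (dB K γ₀ c₀ δ₀) := rB_le_rate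
  have h2γ : (0 : ℝ) ≤ 2 / γ₀ := by positivity
  have h2γB : (0 : ℝ) ≤ 2 / γB := by positivity
  have hεG := epsG_nonneg hK hγ hc hδ
  have hεV := epsV_nonneg hK hγ hc hδ hcQ
  have hcV := cV_nonneg hK hγ hc hδ hcQ
  have hεB := epsB_nonneg hK hγ hc hδ hcQ
  have hεN := epsN_nonneg hK hγ hc hδ hcQ hγB
  have hcU := cU_nonneg hK hγ hc hδ hcQ hγB
  have hεU := epsU_nonneg hK hγ hc hδ hcQ hγB
  -- Step G : decays and window agreement of G_c = A_c⁻¹ at rate rA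
  have hG₁ : Decay ρ pn₁ pn₁ (2 / γ₀) (rA K γ₀ c₀ δ₀) A₁⁻¹ :=
    (Decay.inv_of_hyp56 hK hγ hc.le hδ hρ hPn₁ hA₁).mono hρ h2γ le_rfl hd1
  have hG₂ : Decay ρ pn₂ pn₂ (2 / γ₀) (rA K γ₀ c₀ δ₀) A₂⁻¹ :=
    (Decay.inv_of_hyp56 hK hγ hc.le hδ hρ hPn₂ hA₂).mono hρ h2γ le_rfl hd1
  have hWA : Shape ρ β pmw pmw 0 (B4Sect5Torus.rate K γ₀ c₀ δ₀)
      (A₁.submatrix e₁ e₁ - A₂.submatrix e₂ e₂) := by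
    rw [hAeq, sub_self]; exact Shape.zero pmw pmw le_rfl _
  have hWG : Shape ρ β pmw pmw (epsG K γ₀ c₀ δ₀) (rA K γ₀ c₀ δ₀)
      ((A₁⁻¹).submatrix e₁ e₁ - (A₂⁻¹).submatrix e₂ e₂) :=
    wa_inv hρ hβ hK hγ hc hδ hm₁ hm₂ he₁ he₂ hfarn₁ hfarn₂ hPn₁ hPn₂ hA₁ hA₂ le_rfl hδ₁pos le_rfl hWA
  -- Step Q
  have hQd₁ : Decay ρ pq₁ pn₁ cQ (rA K γ₀ c₀ δ₀) Q₁ := hQ₁.mono hρ hcQ le_rfl (by linarith)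
  have hQd₂ : Decay ρ pq₂ pn₂ cQ (rA K γ₀ c₀ δ₀) Q₂ := hQ₂.mono hρ hcQ le_rfl (by linarith)
  have hWQ : Shape ρ β pww pmw 0 (rA K γ₀ c₀ δ₀) (Q₁.submatrix f₁ e₁ - Q₂.submatrix f₂ e₂) := by
    rw [hQeq, sub_self]; exact Shape.zero pww pmw le_rfl _
  -- Step V = Q * G (rate rA → rA/3)
  have hWV : Shape ρ β pww pmw (epsV K γ₀ c₀ δ₀ cQ) (rA K γ₀ c₀ δ₀ / 3)
      ((Q₁ * A₁⁻¹).submatrix f₁ e₁ - (Q₂ * A₂⁻¹).submatrix f₂ e₂) :=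
    wa_mul hρ hβ hK hw₁ hm₁ hm₁ hw₂ hm₂ hm₂ he₁ he₂ hfarn₁ hfarn₂ hPn₁ hPn₂ hd hcQ h2γ
      le_rfl hεG hQd₁ hQd₂ hG₁ hG₂ hWQ hWG
  have hV₁ : Decay ρ pq₁ pn₁ (cV K γ₀ c₀ δ₀ cQ) (rA K γ₀ c₀ δ₀ / 3) (Q₁ * A₁⁻¹) :=
    (Decay.mul hρ hPn₁ hd hcQ h2γ hQd₁ hG₁).mono hρ hcV le_rfl (by linarith)
  have hV₂ : Decay ρ pq₂ pn₂ (cV K γ₀ c₀ δ₀ cQ) (rA K γ₀ c₀ δ₀ / 3) (Q₂ * A₂⁻¹) :=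
    (Decay.mul hρ hPn₂ hd hcQ h2γ hQd₂ hG₂).mono hρ hcV le_rfl (by linarith)
  -- Step B = V * Vᵀ (rate rA/3 → rA/9)
  have hd3 : 0 < rA K γ₀ c₀ δ₀ / 3 := by positivity
  have hWB : Shape ρ β pww pww (epsB K γ₀ c₀ δ₀ cQ) (rA K γ₀ c₀ δ₀ / 3 / 3)
      ((Q₁ * A₁⁻¹ * (Q₁ * A₁⁻¹).transpose).submatrix f₁ f₁ -
        (Q₂ * A₂⁻¹ * (Q₂ * A₂⁻¹).transpose).submatrix f₂ f₂) :=
    wa_mul hρ hβ hK hw₁ hm₁ hw₁ hw₂ hm₂ hw₂ he₁ he₂ hfarn₁ hfarn₂ hPn₁ hPn₂ hd3 hcV hcV hεV hεV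
      hV₁ hV₂ (hV₁.transpose hρ) (hV₂.transpose hρ) hWV (wa_transpose hρ hWV)
  -- the (5.6) of B_c = V_cV_cᵀ: symmetry is automatic, the kernel bound is `Decay.mul`, coercivity is the input
  have hBd₁ := Decay.mul hρ hPn₁ hd3 hcV hcV hV₁ (hV₁.transpose hρ)
  have hBd₂ := Decay.mul hρ hPn₂ hd3 hcV hcV hV₂ (hV₂.transpose hρ)
  have hB₁ : Hyp56 (fun i j => ρ (pq₁ i) (pq₁ j)) (Q₁ * A₁⁻¹ * (Q₁ * A₁⁻¹).transpose) γB
      (cB K γ₀ c₀ δ₀ cQ) (dB K γ₀ c₀ δ₀) :=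
    ⟨by rw [Matrix.IsSymm, Matrix.transpose_mul, Matrix.transpose_transpose], hcoer₁, fun p q =>
      (hBd₁ p q).trans (mul_le_mul_of_nonneg_right (by unfold cB; linarith) (Real.exp_nonneg _))⟩
  have hB₂ : Hyp56 (fun i j => ρ (pq₂ i) (pq₂ j)) (Q₂ * A₂⁻¹ * (Q₂ * A₂⁻¹).transpose) γB
      (cB K γ₀ c₀ δ₀ cQ) (dB K γ₀ c₀ δ₀) :=
    ⟨by rw [Matrix.IsSymm, Matrix.transpose_mul, Matrix.transpose_transpose], hcoer₂, fun p q =>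
      (hBd₂ p q).trans (mul_le_mul_of_nonneg_right (by unfold cB; linarith) (Real.exp_nonneg _))⟩
  -- Step N = B⁻¹ : window agreement at rate rB → rB/4
  have hWBr : Shape ρ β pww pww (epsB K γ₀ c₀ δ₀ cQ) (rB K γ₀ c₀ δ₀ cQ γB)
      ((Q₁ * A₁⁻¹ * (Q₁ * A₁⁻¹).transpose).submatrix f₁ f₁ -
        (Q₂ * A₂⁻¹ * (Q₂ * A₂⁻¹).transpose).submatrix f₂ f₂) :=
    hWB.mono hρ hβ hεB le_rfl (by linarith)
  have hWN : Shape ρ β pww pww (epsN K γ₀ c₀ δ₀ cQ γB) (rB K γ₀ c₀ δ₀ cQ γB / 4)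
      ((Q₁ * A₁⁻¹ * (Q₁ * A₁⁻¹).transpose)⁻¹.submatrix f₁ f₁ -
        (Q₂ * A₂⁻¹ * (Q₂ * A₂⁻¹).transpose)⁻¹.submatrix f₂ f₂) :=
    wa_inv hρ hβ hK hγB hcB hδB hw₁ hw₂ hf₁ hf₂ hfarq₁ hfarq₂ hPq₁ hPq₂ hB₁ hB₂ hεB hr hrB hWBr
  have hN₁ : Decay ρ pq₁ pq₁ (2 / γB) (rB K γ₀ c₀ δ₀ cQ γB / 4)
      (Q₁ * A₁⁻¹ * (Q₁ * A₁⁻¹).transpose)⁻¹ :=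
    (Decay.inv_of_hyp56 hK hγB hcB.le hδB hρ hPq₁ hB₁).mono hρ h2γB le_rfl (by linarith)
  have hN₂ : Decay ρ pq₂ pq₂ (2 / γB) (rB K γ₀ c₀ δ₀ cQ γB / 4)
      (Q₂ * A₂⁻¹ * (Q₂ * A₂⁻¹).transpose)⁻¹ :=
    (Decay.inv_of_hyp56 hK hγB hcB.le hδB hρ hPq₂ hB₂).mono hρ h2γB le_rfl (by linarith)
  -- Step U = N * V at rate rB/4 → rB/12
  have hr4 : 0 < rB K γ₀ c₀ δ₀ cQ γB / 4 := by positivity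
  have hV₁r : Decay ρ pq₁ pn₁ (cV K γ₀ c₀ δ₀ cQ) (rB K γ₀ c₀ δ₀ cQ γB / 4) (Q₁ * A₁⁻¹) :=
    hV₁.mono hρ hcV le_rfl (by linarith)
  have hV₂r : Decay ρ pq₂ pn₂ (cV K γ₀ c₀ δ₀ cQ) (rB K γ₀ c₀ δ₀ cQ γB / 4) (Q₂ * A₂⁻¹) :=
    hV₂.mono hρ hcV le_rfl (by linarith)
  have hWVr : Shape ρ β pww pmw (epsV K γ₀ c₀ δ₀ cQ) (rB K γ₀ c₀ δ₀ cQ γB / 4)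
      ((Q₁ * A₁⁻¹).submatrix f₁ e₁ - (Q₂ * A₂⁻¹).submatrix f₂ e₂) :=
    hWV.mono hρ hβ hεV le_rfl (by linarith)
  have hWU : Shape ρ β pww pmw (epsU K γ₀ c₀ δ₀ cQ γB) (rB K γ₀ c₀ δ₀ cQ γB / 4 / 3)
      (((Q₁ * A₁⁻¹ * (Q₁ * A₁⁻¹).transpose)⁻¹ * (Q₁ * A₁⁻¹)).submatrix f₁ e₁ -
        ((Q₂ * A₂⁻¹ * (Q₂ * A₂⁻¹).transpose)⁻¹ * (Q₂ * A₂⁻¹)).submatrix f₂ e₂) :=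
    wa_mul hρ hβ hK hw₁ hw₁ hm₁ hw₂ hw₂ hm₂ hf₁ hf₂ hfarq₁ hfarq₂ hPq₁ hPq₂ hr4
      h2γB hcV hεN hεV hN₁ hN₂ hV₁r hV₂r hWN hWVr
  have hU₁ : Decay ρ pq₁ pn₁ (cU K γ₀ c₀ δ₀ cQ γB) (rB K γ₀ c₀ δ₀ cQ γB / 4 / 3)
      ((Q₁ * A₁⁻¹ * (Q₁ * A₁⁻¹).transpose)⁻¹ * (Q₁ * A₁⁻¹)) :=
    (Decay.mul hρ hPq₁ hr4 h2γB hcV hN₁ hV₁r).mono hρ hcU le_rfl (by linarith)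
  have hU₂ : Decay ρ pq₂ pn₂ (cU K γ₀ c₀ δ₀ cQ γB) (rB K γ₀ c₀ δ₀ cQ γB / 4 / 3)
      ((Q₂ * A₂⁻¹ * (Q₂ * A₂⁻¹).transpose)⁻¹ * (Q₂ * A₂⁻¹)) :=
    (Decay.mul hρ hPq₂ hr4 h2γB hcV hN₂ hV₂r).mono hρ hcU le_rfl (by linarith)
  -- Step P = Vᵀ * U at rate rB/12 → rB/36
  have hr12 : 0 < rB K γ₀ c₀ δ₀ cQ γB / 4 / 3 := by positivity
  have hVt₁ : Decay ρ pn₁ pq₁ (cV K γ₀ c₀ δ₀ cQ) (rB K γ₀ c₀ δ₀ cQ γB / 4 / 3)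
      (Q₁ * A₁⁻¹).transpose :=
    (hV₁.transpose hρ).mono hρ hcV le_rfl (by linarith)
  have hVt₂ : Decay ρ pn₂ pq₂ (cV K γ₀ c₀ δ₀ cQ) (rB K γ₀ c₀ δ₀ cQ γB / 4 / 3)
      (Q₂ * A₂⁻¹).transpose :=
    (hV₂.transpose hρ).mono hρ hcV le_rfl (by linarith)
  have hWVt : Shape ρ β pmw pww (epsV K γ₀ c₀ δ₀ cQ) (rB K γ₀ c₀ δ₀ cQ γB / 4 / 3)
      ((Q₁ * A₁⁻¹).transpose.submatrix e₁ f₁ - (Q₂ * A₂⁻¹).transpose.submatrix e₂ f₂) :=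
    (wa_transpose hρ hWV).mono hρ hβ hεV le_rfl (by linarith)
  exact wa_mul hρ hβ hK hm₁ hw₁ hm₁ hm₂ hw₂ hm₂ hf₁ hf₂ hfarq₁ hfarq₂ hPq₁ hPq₂ hr12
    hcV hcU hεV hεU hVt₁ hVt₂ hU₁ hU₂ hWVt hWU

omit [Fintype m] [DecidableEq m] [Fintype q₁] [DecidableEq q₁] in
/-- for a symmetric invertible-or-not `A`, `(QA⁻¹)ᵀ = A⁻¹Qᵀ`: the `VᵀB⁻¹V` of `projection_window_agree` is the
printed `G′Q′*(Q′G′²Q′*)⁻¹Q′G′` and `VVᵀ = Q′G′G′Q′* = Q′G′²Q′*`. [folklore] -/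
theorem transpose_mul_inv_eq {A : Matrix n₁ n₁ ℝ} (hA : A.IsSymm) (Q : Matrix q₁ n₁ ℝ) :
    (Q * A⁻¹).transpose = A⁻¹ * Q.transpose := by
  rw [Matrix.transpose_mul, Matrix.transpose_nonsing_inv, hA.eq]

end Projection

end Literature.MathematicalPhysics.QuantumFieldTheory.Balaban1983to89.B6DomainChange
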